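import Summits.CriticalPhenomena.CardyFormulaZ2.Theses.CardySelfRefinement
import Literature.Probability.LatticeModels.UnitDiscDiscretisation
import Literature.Probability.LatticeModels.DobrushinDiscretisationBridge
import Literature.Probability.Percolation.QuadCrossingSubseqLimits
import Literature.Probability.RandomPlanarGeometry.ChordalCurveFamilyProofs
import Mathlib.MeasureTheory.Function.ContinuousMapDense
import Mathlib.Topology.MetricSpace.Thickening

/-!
# Disproof work file for crux `LagHandOff` (stmt-CriticalPhenomena-10268, route CardySelfRefinement)

Standing adversary's Lean record (refuter `cdisprove`).  Prose lives in docstrings only.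

## Findings (index)

* `lagHandOff_iff`, `not_lagHandOff_iff` — the crux is `RotationInput → ScaleInvariantLimits →
  Conclusion`; a Lean refutation must PROVE both antecedents (DKKMO rotation invariance in
  `ℋ`-form, not formalised; dilation invariance of all subsequential limits = the open
  scale-invariance problem) and refute `Conclusion`.  This is the structural reason the crux
  resists disproof: no element of `subseqQuadLimits univ` is constructible in the tree.
* `hyps_of_subseqQuadLimits_eq_empty`, `hyps_of_subseqQuadLimits_subset_zero`,
  `isometryLaw_zero`, `dilateLaw_zero` — VACUITY CHANNELS of the antecedents: they hold for junk
  reasons if `Λ = subseqQuadLimits univ` is empty (non-emptiness needs SS11 Thm 1.4 + Prokhorov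
  — cycle 3: now PROVED, `subseqQuadLimits_nonempty`) or consists of zero laws (which is what
  `crossingLaw` produces if `configOf` is not a.e.-measurable — cycle 3: excluded,
  `ne_zero_of_mem_subseqQuadLimits`, via the tree's `measurable_z2QuadConfig`).
  In either junk regime `LagHandOff` collapses to its bare `Conclusion` (percolation interfaces
  → one local Markov chordal family along subsequences), which is believed TRUE and is not
  refutable; so the antecedents give a prover no leverage until those two facts are in the tree.
* `NoTraceAt`, `arcFamily_traces_boundary` — the no-boundary-tracing clause has teeth: the
  chordal, similarity-covariant test family `arcFamily` (Dirac mass on the arc `(ab)`) violates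
  it in every Dobrushin domain.
* `ConclusionWithoutGuard`, `conclusion_false_without_discretisation_guard` — LOAD-BEARING
  ANALYSIS: dropping the admissibility guard `ZdDiscretisationFamily D E →` from clause (ii)
  makes the conclusion FALSE: for the empty discrete domain the interface is G02's junk constant
  curve `0`, whose Dirac law cannot converge to a chordal law of the unit disc (`a = 1 ≠ 0`).
  Any proof of (ii) must therefore use admissibility of `E δ` (it is the only source of
  information about `bondInterfaceIn`).
* `bondInterfaceIn_mesh_zero`, `conclusion_false_without_mesh_positivity` — LOAD-BEARING
  ANALYSIS: the guard `∀ n, 0 < δs n` of clause (ii) is load-bearing too, even WITH the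
  admissibility guard: at mesh `0` every medial point is the origin, so the interface of ANY data
  is the constant curve `0`; with `δs ≡ 0` and the genuine discretisation family
  `UnitDiscDiscretisation.discData` of the unit disc (so the admissibility guard is satisfiable —
  the convergence clause of (ii) is NOT vacuous) the clause fails.
* `measurable_bondInterfaceIn`, `lagHandOff_clause_i` — POSITIVE by-product: clause (i)
  (eventual a.e.-measurability of the interfaces of a discretisation family) holds OUTRIGHT, with
  no hypothesis: the interface factors through the finitely many edge coordinates of `Ω_δ`
  (bounded domain, `δ > 0`), junk branch of `medialExploration` included.  So the entire weight
  of the crux is clause (ii).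

## Cycle 3 additions (refuter g3, 2026-08-16) — see the section `## Cycle 3` below

* `lagHandOff_iff_clauseII` — the crux is `RotationInput → ScaleInvariantLimits → ClauseII`.
* `quadCompactness` (= STUB 1 of line `crosscut-dictionary`, proved), `subseqQuadLimits_nonempty`,
  `ne_zero_of_mem_subseqQuadLimits` — BOTH VACUITY CHANNELS BELOW ARE NOW CLOSED BY THEOREMS
  (`Λ ≠ ∅`, every `μ ∈ Λ` is a probability law): the antecedents are genuine, so `¬ LagHandOff`
  would require PROVING scale invariance of bond-`ℤ²` limits (open) and DKKMO in `ℋ`-form.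
* `Targets.*` — attacks on the seven stubs of the picked line `crosscut-dictionary`: no kill;
  the combinatorial obstruction behind STUB 5 `stub_discretisable`
  (`Targets.not_isZdAdmissible_of_three_chains`: `{e_a, e_b}` must be a 2-edge cut of the
  boundary graph) with the free-zone analysis a prover needs; status notes for STUBS 2–4, 6–7.
* `not_clauseII_of_two_families`, `not_clauseII_of_moved_incoherent`,
  `not_clauseII_of_same_carrier_incoherent`, `eq_of_isLocal_of_carrier_eq` — the cycle-2 kill
  templates re-derived (the cycle-2 text itself never reached this path, see the note below).

## Cycle 4 additions (refuter g4, 2026-08-16) — see the section `## Cycle 4` below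

* Negative lemmas of cycles 1–4 LANDED under `Theorems/LagHandOff/Negative/` (Structure, Guards,
  KillTemplates, StopAtDiscontinuity, DictionaryMerging) — import them rather than this work file.
* `not_continuousAt_mk_stopAt` (+ `_arch` witness) — TARGETS STUBS 6–7: `stopAt F` is
  discontinuous at one-sided touching (the `D'`-side of `IsLocal`, `F = D.arc 1` in
  `IsTargetIndependent`): the "continuity of `stopAt` at the limit law" step is unavailable there.
* `interfaces_merge_of_handsOff'` — NC1 certified: STUB 2's hands-off ⇒ interfaces of two
  admissible families of one domain merge pathwise along every positive null sequence.

## Why the crux resists (cycle 1 verdict; sharpened in cycle 3: the junk regimes are now EXCLUDED,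
## so the only route to `¬ LagHandOff` runs through a proof of `ScaleInvariantLimits`)

No Lean refutation is possible today: `¬ LagHandOff` needs the two antecedents PROVED, and
`subseqQuadLimits univ` has no constructible element.  On paper every junk channel checked closes:
zero laws / empty `Λ` (antecedents become vacuous, crux = conclusion, believed true); the
`orientCurve` endpoint rule; the freedom left by `ZdDiscretisationFamily` (only an `o(1)` wiggle of
the discrete marked points; the guard is satisfiable: `UnitDiscDiscretisation.discData`); the
arc-swap / reflection consistency forced by `IsLocal` (P D depends on carrier + marked points
only — consistent with self-duality + reflection symmetry of bond-`ℤ²`); the prime-end caveat of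
the set-based Markov axiom (the tip of `γ.stopAt F` is never a double point of the stopped curve,
boundary-touching tips are null); `NoTraceAt` holds for SLE₆ in every Jordan domain
(Carathéodory + `SLE₆ ∩ ℝ` contains no interval).  The conclusion is the CN07/Smirnov-type
convergence along subsequences packaged with axioms SLE₆ satisfies — deep, believed, unrefutable.
Print check (held text arXiv:1008.1378 = GarbanPeteSchramm2013Pivotal, materialised pp. 10, 16):
Cor. 9 gives, on `𝕋` and for smooth `(Ω; a, b)`, convergence of the exploration TRACE (Hausdorff
topology) to an SLE₆ trace measurable w.r.t. the quad-crossing limit; Question 10 — "Is it the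
case that the chordal SLE₆ curve is measurable with respect to the quad-crossing continuum
percolation ω inside (Ω, a, b)?" — is left OPEN (curve topology), and p. 10 records that on `ℤ²`
only the ingredients not using uniqueness / conformal invariance survive along subsequences.  The
quad → curve dictionary inside clause (ii) thus contains Question 10-type content: open, not
refutable, and not circumventable (similarity covariance of `P` along ONE subsequence is itself a
scale-invariance statement for interface laws, so the antecedents must be transferred).
Gate note: refuters may land only `¬ <Theses decl>` files, so the lemmas of this file travel as
item evidence (the `Theorems/<Crux>/Negative/` target of the cdisprove protocol is not accepted by
the gate's target regex).
-/

noncomputable section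

open MeasureTheory Filter Set Topology
open scoped BoundedContinuousFunction
open Literature.Probability.Percolation Literature.Probability.LatticeModels
open Literature.Probability.RandomPlanarGeometry Literature.Probability.Percolation.QuadCrossing
open Summit.CriticalPhenomena.CardyFormulaZ2.Theses.CardySelfRefinement

namespace Summit.CriticalPhenomena.CardyFormulaZ2.Cruxes.LagHandOff.Disproof

/-! ### Logical shape of the crux -/

/-- "A.s. no boundary tracing" at one curve class of the Dobrushin domain `D` (the clause of
`LagHandOff` (ii), verbatim). -/
def NoTraceAt (D : DobrushinDomain) (γ : CurveClass ℂ) : Prop :=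
  ∀ c : Curve ℂ, CurveClass.mk c = γ → ∀ s t : unitInterval, s < t →
    c '' Set.Icc s t ⊆ frontier D.carrier → (c '' Set.Icc s t).Subsingleton

/-- The conclusion of `LagHandOff` (clauses (i) and (ii)), verbatim. -/
def Conclusion : Prop :=
  (∀ (D : DobrushinDomain) (E : ℝ → DiscreteDobrushin), ZdDiscretisationFamily D E →
    ∀ᶠ δ in nhdsWithin (0 : ℝ) (Set.Ioi 0),
      AEMeasurable (bondInterfaceIn D (E δ)) (bondPercolation (zdGraph 2) half)) ∧
  ∀ δs : ℕ → ℝ, (∀ n, 0 < δs n) → Filter.Tendsto δs Filter.atTop (nhds 0) →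
    ∃ φ : ℕ → ℕ, StrictMono φ ∧ ∃ P : ChordalFamily, IsLocalMarkovChordalFamily P ∧
      (∀ D : DobrushinDomain, ∀ᵐ γ ∂(P D), NoTraceAt D γ) ∧
      (∀ (D : DobrushinDomain) (E : ℝ → DiscreteDobrushin), ZdDiscretisationFamily D E →
        ∀ f : BoundedContinuousFunction (CurveClass ℂ) ℝ,
          Filter.Tendsto (fun n => ∫ ω, f (bondInterfaceIn D (E (δs (φ n))) ω)
            ∂(bondPercolation (zdGraph 2) half)) Filter.atTop (nhds (∫ γ, f γ ∂(P D))))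

/-- `LagHandOff` is literally `RotationInput → ScaleInvariantLimits → Conclusion`. -/
theorem lagHandOff_iff : LagHandOff ↔ (RotationInput → ScaleInvariantLimits → Conclusion) :=
  Iff.rfl

/-- OBSTRUCTION TO DISPROOF: refuting the crux means proving both antecedents and refuting the
conclusion. -/
theorem not_lagHandOff_iff :
    ¬ LagHandOff ↔ (RotationInput ∧ ScaleInvariantLimits ∧ ¬ Conclusion) := by
  rw [lagHandOff_iff]; tauto

/-! ### Vacuity channels of the antecedents -/

/-- The zero law on `ℋ_ℂ` is invariant under every Euclidean motion (push-forward of `0`). -/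
theorem isometryLaw_zero (g : ℂ ≃ᵢ ℂ) : isometryLaw g 0 = 0 := by
  apply Subtype.ext
  simp [isometryLaw, FiniteMeasure.toMeasure_map]

/-- The zero law on `ℋ_ℂ` is invariant under every dilation. -/
theorem dilateLaw_zero (t : ℝ) (ht : t ≠ 0) : dilateLaw t ht 0 = 0 := by
  apply Subtype.ext
  simp [dilateLaw, FiniteMeasure.toMeasure_map]

/-- Channel 1: if `Λ = ∅` (non-emptiness is SS11 Thm 1.4 + Prokhorov, unproved in tree) both
antecedents hold vacuously and the crux IS its conclusion. -/
theorem hyps_of_subseqQuadLimits_eq_empty (h : subseqQuadLimits (Set.univ : Set ℂ) = ∅) :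
    RotationInput ∧ ScaleInvariantLimits := by
  constructor
  · intro μ hμ; rw [h] at hμ; exact hμ.elim
  · intro μ hμ; rw [h] at hμ; exact hμ.elim

/-- Channel 2: if every subsequential limit is the zero law (which is what the laws
`squareCrossingLaw univ δ = map (configOf …) P` would all be, were `configOf` not
a.e.-measurable) both antecedents hold trivially. -/
theorem hyps_of_subseqQuadLimits_subset_zero
    (h : ∀ μ ∈ subseqQuadLimits (Set.univ : Set ℂ), μ = 0) :
    RotationInput ∧ ScaleInvariantLimits := by
  constructor
  · intro μ hμ α; rw [h μ hμ]; exact isometryLaw_zero _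
  · intro μ hμ t ht; rw [h μ hμ]; exact dilateLaw_zero t ht.ne'

/-- In either junk regime the crux collapses to its bare conclusion. -/
theorem lagHandOff_iff_conclusion_of_hyps (h : RotationInput ∧ ScaleInvariantLimits) :
    LagHandOff ↔ Conclusion :=
  ⟨fun hL => hL h.1 h.2, fun hC _ _ => hC⟩

/-! ### The no-tracing clause has teeth -/

/-- The boundary-running test family `arcFamily` (chordal and similarity covariant, see
`ChordalCurveFamily.lean`) violates the no-tracing clause in EVERY Dobrushin domain: its curve
is the arc `(ab) ⊆ ∂D`, which contains the two distinct points `a`, `b`. -/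
theorem arcFamily_traces_boundary (D : DobrushinDomain) :
    ¬ (∀ᵐ γ ∂(ChordalFamily.arcFamily D), NoTraceAt D γ) := by
  intro h
  rw [ChordalFamily.arcFamily, ae_dirac_eq, eventually_pure] at h
  have hsub : (D.arcCurve 0 : Curve ℂ) '' Set.Icc (0 : unitInterval) 1 ⊆ frontier D.carrier := by
    rintro _ ⟨s, -, rfl⟩
    exact D.arc_subset_frontier 0 (D.range_arcCurve_subset 0 ⟨s, rfl⟩)
  have h1 := h (D.arcCurve 0) rfl 0 1 zero_lt_one hsub
  have ha : D.pt 0 ∈ (D.arcCurve 0 : Curve ℂ) '' Set.Icc (0 : unitInterval) 1 :=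
    ⟨0, ⟨le_rfl, zero_le_one⟩, by simpa [Curve.source_def] using D.source_arcCurve 0⟩
  have hb : D.pt 1 ∈ (D.arcCurve 0 : Curve ℂ) '' Set.Icc (0 : unitInterval) 1 :=
    ⟨1, ⟨zero_le_one, le_rfl⟩, by simpa [Curve.target_def] using D.target_arcCurve 0⟩
  exact D.pt_injective.ne (by decide : (0 : Fin 2) ≠ 1) (h1 ha hb)

/-! ### Load-bearing analysis: the admissibility guard of clause (ii) -/

/-- The EMPTY discrete Dobrushin data at mesh `δ` (no domain, no arcs): not admissible. -/
def emptyData (δ : ℝ) : DiscreteDobrushin := ⟨∅, δ, ∅, ∅⟩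

theorem meshDomain_empty (δ : ℝ) : meshDomain (∅ : Set ℂ) δ = ∅ := by
  apply Set.eq_empty_of_subset_empty
  intro x hx
  have := meshDomain_subset_meshVertices _ _ hx
  simp at this

theorem not_adj_discreteDomainGraph_empty (δ : ℝ) (x y : Site 2) :
    ¬ (discreteDomainGraph (∅ : Set ℂ) δ).Adj x y := fun h => by
  have := (discreteDomainGraph_adj_iff.1 h).2.1
  rw [meshDomain_empty] at this
  exact this

theorem zdABEdges_emptyData (δ : ℝ) : (emptyData δ).zdABEdges = ∅ := by
  apply Set.eq_empty_of_subset_empty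
  intro e he
  rw [DiscreteDobrushin.mem_zdABEdges_iff] at he
  obtain ⟨he, -, -⟩ := he
  revert he
  refine Sym2.ind (fun x y hxy => ?_) e
  exact not_adj_discreteDomainGraph_empty δ x y ((SimpleGraph.mem_edgeSet _).1 hxy)

theorem not_isMedialExploration_emptyData (δ : ℝ) (ω : BondConfig (Site 2))
    (γ : List MedialVertex) : ¬ IsMedialExploration (emptyData δ) ω γ := fun h => by
  have := h.head_mem
  rw [zdABEdges_emptyData] at this
  exact this

theorem medialExploration_emptyData (δ : ℝ) (ω : BondConfig (Site 2)) :
    medialExploration (emptyData δ) ω = [] := by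
  unfold medialExploration
  rw [dif_neg]
  rintro ⟨γ, hγ, -⟩
  exact not_isMedialExploration_emptyData δ ω γ hγ

theorem medialExplorationCurve_emptyData (δ : ℝ) (ω : BondConfig (Site 2)) :
    medialExplorationCurve (emptyData δ) ω = ContinuousMap.const _ 0 := by
  simp [medialExplorationCurve, medialExploration_emptyData]

theorem reverseCurve_const {E : Type*} [TopologicalSpace E] (x : E) :
    reverseCurve (ContinuousMap.const unitInterval x) = ContinuousMap.const unitInterval x := by
  ext t; simp

theorem orientCurve_const (D : DobrushinDomain) (x : ℂ) :
    orientCurve D (ContinuousMap.const unitInterval x) = Curve.const x := by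
  rcases orientCurve_eq_or D (ContinuousMap.const unitInterval x) with h | h
  · rw [h]; rfl
  · rw [h, reverseCurve_const]; rfl

/-- Off admissible data the interface is G02's junk: for the empty data it is the class of the
constant curve `0`, whatever the configuration. -/
theorem bondInterfaceIn_emptyData (D : DobrushinDomain) (δ : ℝ) (ω : BondConfig (Site 2)) :
    bondInterfaceIn D (emptyData δ) ω = CurveClass.mk (Curve.const 0) := by
  rw [bondInterfaceIn_apply, medialExplorationCurve_emptyData, orientCurve_const]

/-- Clause (ii) of the conclusion of `LagHandOff` with the admissibility guard
`ZdDiscretisationFamily D E →` DROPPED from the convergence requirement. -/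
def ConclusionWithoutGuard : Prop :=
  ∀ δs : ℕ → ℝ, (∀ n, 0 < δs n) → Filter.Tendsto δs Filter.atTop (nhds 0) →
    ∃ φ : ℕ → ℕ, StrictMono φ ∧ ∃ P : ChordalFamily, IsLocalMarkovChordalFamily P ∧
      (∀ D : DobrushinDomain, ∀ᵐ γ ∂(P D), ∀ c : Curve ℂ, CurveClass.mk c = γ →
        ∀ s t : unitInterval, s < t → c '' Set.Icc s t ⊆ frontier D.carrier →
          (c '' Set.Icc s t).Subsingleton) ∧
      (∀ (D : DobrushinDomain) (E : ℝ → DiscreteDobrushin),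
        ∀ f : BoundedContinuousFunction (CurveClass ℂ) ℝ,
          Filter.Tendsto (fun n => ∫ ω, f (bondInterfaceIn D (E (δs (φ n))) ω)
            ∂(bondPercolation (zdGraph 2) half)) Filter.atTop (nhds (∫ γ, f γ ∂(P D))))

/-- The test functional `γ ↦ min 1 (dist γ.source p)`, bounded continuous. -/
def sourceDistBCF (p : ℂ) : BoundedContinuousFunction (CurveClass ℂ) ℝ :=
  BoundedContinuousFunction.ofNormedAddCommGroup (fun γ => min 1 (dist γ.source p))
    (continuous_const.min (CurveClass.continuous_source.dist continuous_const)) 1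
    (fun γ => by
      rw [Real.norm_eq_abs, abs_of_nonneg (le_min zero_le_one dist_nonneg)]
      exact min_le_left _ _)

@[simp] theorem sourceDistBCF_apply (p : ℂ) (γ : CurveClass ℂ) :
    sourceDistBCF p γ = min 1 (dist γ.source p) := rfl

theorem norm_pt_unitDisc (i : Fin 2) : ‖DobrushinDomain.unitDisc.pt i‖ = 1 := by
  have h := DobrushinDomain.unitDisc.pt_mem_frontier i
  have hc : DobrushinDomain.unitDisc.carrier = Metric.ball (0 : ℂ) 1 := rfl
  rw [hc, frontier_ball (0 : ℂ) one_ne_zero] at h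
  simpa using h

/-- LOAD-BEARING: without the admissibility guard clause (ii) is false (witness: the unit disc,
the empty discrete data, the test functional `min 1 (dist source a)`). -/
theorem conclusion_false_without_discretisation_guard : ¬ ConclusionWithoutGuard := by
  intro h
  obtain ⟨φ, -, P, hP, -, hconv⟩ := h (fun n => 1 / ((n : ℝ) + 1))
    (fun n => by positivity) tendsto_one_div_add_atTop_nhds_zero_nat
  set D := DobrushinDomain.unitDisc with hD
  set f := sourceDistBCF (D.pt 0) with hf
  have hlim := hconv D emptyData f
  -- the discrete side is the constant `f (mk (const 0)) = 1`
  have hconst : (fun n => ∫ ω, f (bondInterfaceIn D (emptyData (1 / ((φ n : ℝ) + 1))) ω)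
      ∂(bondPercolation (zdGraph 2) half)) = fun _ => (1 : ℝ) := by
    funext n
    have hpt : (fun ω => f (bondInterfaceIn D (emptyData (1 / ((φ n : ℝ) + 1))) ω)) =
        fun _ => (1 : ℝ) := by
      funext ω
      rw [bondInterfaceIn_emptyData, hf, sourceDistBCF_apply, CurveClass.source_mk,
        Curve.source_def, Curve.const_apply, dist_comm, dist_zero_right, norm_pt_unitDisc,
        min_self]
    rw [hpt, integral_const, probReal_univ, one_smul]
  rw [hconst] at hlim
  have h1 : ∫ γ, f γ ∂(P D) = 1 := (tendsto_nhds_unique tendsto_const_nhds hlim).symm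
  -- the continuum side vanishes: a.s. `source = a`
  have h0 : ∫ γ, f γ ∂(P D) = 0 := by
    apply integral_eq_zero_of_ae
    filter_upwards [(hP.isChordal D).2] with γ hγ
    simp [hf, hγ.1]
  rw [h0] at h1
  exact zero_ne_one h1

/-! ### Load-bearing analysis: the mesh-positivity guard of clause (ii) -/

/-- A polyline all of whose vertices coincide is constant (as a set). -/
theorem range_polylineFrom_subset_singleton {E : Type*} [AddCommGroup E] [Module ℝ E]
    [TopologicalSpace E] [ContinuousAdd E] [ContinuousSMul ℝ E] (a : E) :
    ∀ l : List E, (∀ y ∈ l, y = a) → Set.range (polylineFrom a l).2 ⊆ {a}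
  | [], _ => by
    rintro _ ⟨t, rfl⟩
    simp only [polylineFrom_nil, Set.mem_singleton_iff]
    exact Path.refl_apply a t
  | b :: l, h => by
    have hb : b = a := h b (by simp)
    subst hb
    rw [polylineFrom_cons, Path.trans_range, Path.range_segment, segment_same]
    exact Set.union_subset subset_rfl
      (range_polylineFrom_subset_singleton b l fun y hy => h y (by simp [hy]))

/-- At mesh `0` every medial point is the origin, so G02's exploration polyline is the constant
curve `0` (whatever the data and the configuration). -/
theorem medialExplorationCurve_mesh_zero (E : DiscreteDobrushin) (hE : E.δ = 0)
    (ω : BondConfig (Site 2)) : medialExplorationCurve E ω = ContinuousMap.const _ 0 := by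
  have hpt : ∀ e : MedialVertex, medialPoint E.δ e = 0 := by
    intro e
    induction e using Sym2.ind with
    | _ x y => simp [medialPoint_mk, meshPoint, hE]
  unfold medialExplorationCurve
  cases hl : medialExploration E ω with
  | nil => simp
  | cons e l =>
    rw [List.map_cons, hpt e]
    ext t
    have hmem : (polyline ((0 : ℂ) :: l.map (medialPoint E.δ))) t ∈ ({0} : Set ℂ) := by
      refine range_polylineFrom_subset_singleton (0 : ℂ) (l.map (medialPoint E.δ)) ?_ ⟨t, rfl⟩
      intro y hy
      obtain ⟨e', -, rfl⟩ := List.mem_map.1 hy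
      exact hpt e'
    simpa using hmem

/-- Hence at mesh `0` the bond interface is the class of the constant curve `0`. -/
theorem bondInterfaceIn_mesh_zero (D : DobrushinDomain) (E : DiscreteDobrushin) (hE : E.δ = 0)
    (ω : BondConfig (Site 2)) : bondInterfaceIn D E ω = CurveClass.mk (Curve.const 0) := by
  have hrev : ∀ x : ℂ, reverseCurve (ContinuousMap.const unitInterval x) =
      ContinuousMap.const unitInterval x := fun x => by ext t; simp
  rw [bondInterfaceIn_apply, medialExplorationCurve_mesh_zero E hE]
  rcases orientCurve_eq_or D (ContinuousMap.const unitInterval (0 : ℂ)) with h | h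
  · rw [h]; rfl
  · rw [h, hrev]; rfl

/-- LOAD-BEARING: the positivity guard `∀ n, 0 < δs n` of clause (ii).  With it dropped the
clause is FALSE even WITH the admissibility guard: take `δs ≡ 0` (tends to `0`), the unit disc
and the genuine discretisation family `UnitDiscDiscretisation.discData` (whose mesh-`0` member
has mesh `0`, interface ≡ class of the constant curve `0`). -/
theorem conclusion_false_without_mesh_positivity :
    ¬ (∀ δs : ℕ → ℝ, Filter.Tendsto δs Filter.atTop (nhds 0) →
        ∃ φ : ℕ → ℕ, StrictMono φ ∧ ∃ P : ChordalFamily, IsLocalMarkovChordalFamily P ∧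
          (∀ D : DobrushinDomain, ∀ᵐ γ ∂(P D), ∀ c : Curve ℂ, CurveClass.mk c = γ →
            ∀ s t : unitInterval, s < t → c '' Set.Icc s t ⊆ frontier D.carrier →
              (c '' Set.Icc s t).Subsingleton) ∧
          (∀ (D : DobrushinDomain) (E : ℝ → DiscreteDobrushin), ZdDiscretisationFamily D E →
            ∀ f : BoundedContinuousFunction (CurveClass ℂ) ℝ,
              Filter.Tendsto (fun n => ∫ ω, f (bondInterfaceIn D (E (δs (φ n))) ω)
                ∂(bondPercolation (zdGraph 2) half)) Filter.atTop (nhds (∫ γ, f γ ∂(P D))))) := by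
  intro h
  obtain ⟨φ, -, P, hP, -, hconv⟩ := h (fun _ => 0) tendsto_const_nhds
  set D := DobrushinDomain.unitDisc with hD
  set f : BoundedContinuousFunction (CurveClass ℂ) ℝ :=
    BoundedContinuousFunction.ofNormedAddCommGroup (fun γ => min 1 (dist γ.source (D.pt 0)))
      (continuous_const.min (CurveClass.continuous_source.dist continuous_const)) 1
      (fun γ => by
        rw [Real.norm_eq_abs, abs_of_nonneg (le_min zero_le_one dist_nonneg)]
        exact min_le_left _ _) with hf
  have hf_apply : ∀ γ, f γ = min 1 (dist γ.source (D.pt 0)) := fun γ => rfl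
  have hnorm : ‖D.pt 0‖ = 1 := by
    have h := D.pt_mem_frontier 0
    have hc : D.carrier = Metric.ball (0 : ℂ) 1 := rfl
    rw [hc, frontier_ball (0 : ℂ) one_ne_zero] at h
    simpa using h
  have hE : ZdDiscretisationFamily D UnitDiscDiscretisation.discData :=
    UnitDiscDiscretisation.isDiscretisation_discData.toZdDiscretisationFamily
  have hlim := hconv D UnitDiscDiscretisation.discData hE f
  have hconst : (fun n => ∫ ω, f (bondInterfaceIn D (UnitDiscDiscretisation.discData
      ((fun _ => (0 : ℝ)) (φ n))) ω) ∂(bondPercolation (zdGraph 2) half)) = fun _ => (1 : ℝ) := by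
    funext n
    have hpt : (fun ω => f (bondInterfaceIn D (UnitDiscDiscretisation.discData
        ((fun _ => (0 : ℝ)) (φ n))) ω)) = fun _ => (1 : ℝ) := by
      funext ω
      rw [bondInterfaceIn_mesh_zero D _ rfl, hf_apply, CurveClass.source_mk, Curve.source_def,
        Curve.const_apply, dist_comm, dist_zero_right, hnorm, min_self]
    rw [hpt, integral_const, probReal_univ, one_smul]
  rw [hconst] at hlim
  have h1 : ∫ γ, f γ ∂(P D) = 1 := (tendsto_nhds_unique tendsto_const_nhds hlim).symm
  have h0 : ∫ γ, f γ ∂(P D) = 0 := by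
    apply integral_eq_zero_of_ae
    filter_upwards [(hP.isChordal D).2] with γ hγ
    simp [hf_apply, hγ.1]
  rw [h0] at h1
  exact zero_ne_one h1

/-! ### Positive by-product (for provers): clause (i) holds outright -/

/-- The boundary-condition-completed configuration only reads the edges of `Ω_δ`. -/
theorem bcBondConfig_inter_eq (E : DiscreteDobrushin) {S : Set (Sym2 (Site 2))}
    (hS : (discreteDomainGraph E.Ω E.δ).edgeSet ⊆ S) (ω : BondConfig (Site 2)) :
    E.bcBondConfig (ω ∩ S) = E.bcBondConfig ω := by
  ext e
  simp only [DiscreteDobrushin.mem_bcBondConfig_iff, Set.mem_inter_iff]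
  constructor
  · rintro ⟨he, h | ⟨⟨hω, -⟩, hB⟩⟩
    · exact ⟨he, Or.inl h⟩
    · exact ⟨he, Or.inr ⟨hω, hB⟩⟩
  · rintro ⟨he, h | ⟨hω, hB⟩⟩
    · exact ⟨he, Or.inl h⟩
    · exact ⟨he, Or.inr ⟨⟨hω, hS he⟩, hB⟩⟩

/-- Exploration paths only depend on the completed configuration. -/
theorem isMedialExploration_congr (E : DiscreteDobrushin) {ω ω' : BondConfig (Site 2)}
    (h : E.bcBondConfig ω = E.bcBondConfig ω') (γ : List MedialVertex) :
    IsMedialExploration E ω γ ↔ IsMedialExploration E ω' γ := by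
  constructor
  · intro hγ
    exact { ne_nil := hγ.ne_nil, step := hγ.step, turn := h ▸ hγ.turn, nodup := hγ.nodup,
            head_mem := hγ.head_mem, getLast_mem := hγ.getLast_mem,
            head_ne_getLast := hγ.head_ne_getLast, start := hγ.start }
  · intro hγ
    exact { ne_nil := hγ.ne_nil, step := hγ.step, turn := h.symm ▸ hγ.turn, nodup := hγ.nodup,
            head_mem := hγ.head_mem, getLast_mem := hγ.getLast_mem,
            head_ne_getLast := hγ.head_ne_getLast, start := hγ.start }

/-- Hence so does G02's exploration path (junk branch included). -/
theorem medialExploration_congr (E : DiscreteDobrushin) {ω ω' : BondConfig (Site 2)}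
    (h : E.bcBondConfig ω = E.bcBondConfig ω') :
    medialExploration E ω = medialExploration E ω' := by
  classical
  have hP : IsMedialExploration E ω = IsMedialExploration E ω' :=
    funext fun γ => propext (isMedialExploration_congr E h γ)
  unfold medialExploration
  exact congrArg (fun P : List MedialVertex → Prop =>
    if hp : ∃! γ, P γ then hp.exists.choose else ([] : List MedialVertex)) hP

/-- And the interface. -/
theorem bondInterfaceIn_congr (D : DobrushinDomain) (E : DiscreteDobrushin)
    {ω ω' : BondConfig (Site 2)} (h : E.bcBondConfig ω = E.bcBondConfig ω') :
    bondInterfaceIn D E ω = bondInterfaceIn D E ω' := by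
  simp only [bondInterfaceIn_apply, medialExplorationCurve, medialExploration_congr E h]

/-- MEASURABILITY of the bond interface for data with finitely many domain edges: it factors
through the restriction `ω ↦ ω ∩ S` to the finite edge set `S` of `Ω_δ`, i.e. through the finite
measurable space `Set S`, on which every map is measurable. -/
theorem measurable_bondInterfaceIn (D : DobrushinDomain) (E : DiscreteDobrushin)
    (hfin : (discreteDomainGraph E.Ω E.δ).edgeSet.Finite) :
    Measurable (bondInterfaceIn D E) := by
  set S := (discreteDomainGraph E.Ω E.δ).edgeSet with hSdef
  haveI : Finite S := hfin.to_subtype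
  -- restriction to the edge coordinates of `Ω_δ` and extension by closing everything else
  let restr : BondConfig (Site 2) → Set S := fun ω => {e | (e : Sym2 (Site 2)) ∈ ω}
  let extd : Set S → BondConfig (Site 2) := fun c => {e | ∃ h : e ∈ S, (⟨e, h⟩ : S) ∈ c}
  have hrestr : Measurable restr := measurable_set_iff.2 fun e => measurable_set_mem _
  have hext : ∀ ω, extd (restr ω) = ω ∩ S := by
    intro ω; ext e
    simp only [extd, restr, Set.mem_setOf_eq, Set.mem_inter_iff]
    constructor
    · rintro ⟨h, h'⟩; exact ⟨h', h⟩
    · rintro ⟨h', h⟩; exact ⟨h, h'⟩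
  have hfac : bondInterfaceIn D E = (fun c => bondInterfaceIn D E (extd c)) ∘ restr := by
    funext ω
    simp only [Function.comp_apply, hext]
    exact bondInterfaceIn_congr D E (bcBondConfig_inter_eq E subset_rfl ω).symm
  rw [hfac]
  exact (measurable_of_finite _).comp hrestr

/-- Clause (i) of `LagHandOff` holds OUTRIGHT (no hypotheses): for a discretisation family of a
(bounded) Dobrushin domain the interface is measurable at every positive mesh. -/
theorem lagHandOff_clause_i (D : DobrushinDomain) (E : ℝ → DiscreteDobrushin)
    (hE : ZdDiscretisationFamily D E) :
    ∀ᶠ δ in nhdsWithin (0 : ℝ) (Set.Ioi 0),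
      AEMeasurable (bondInterfaceIn D (E δ)) (bondPercolation (zdGraph 2) half) := by
  refine eventually_nhdsWithin_of_forall fun δ (hδ : 0 < δ) => ?_
  refine (measurable_bondInterfaceIn D (E δ) ?_).aemeasurable
  -- the edge set of `Ω_δ` sits inside `Sym2` of the finite vertex set `meshDomain`
  have hV : (meshDomain (E δ).Ω (E δ).δ).Finite := hE.meshDomain_finite hδ
  refine ((hV.prod hV).image (fun p : Site 2 × Site 2 => s(p.1, p.2))).subset ?_
  intro e he
  induction e using Sym2.ind with
  | _ x y =>
    have hadj := (SimpleGraph.mem_edgeSet _).1 he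
    have h := discreteDomainGraph_adj_iff.1 hadj
    exact ⟨(x, y), ⟨h.2.1, h.2.2⟩, rfl⟩

/-! ## Cycle 3 (refuter cdisprove g3)

NOTE ON PROVENANCE.  The cycle-2 extension of this file (g2, 1 311 lines: `lagHandOff_iff_clauseII`,
dilation infrastructure `bondInterfaceIn_dil` / `zdDiscretisationFamily_dil`, scale coherence
`clauseII_scale_coherent`, the kill templates `not_clauseII_of_logPeriodic`,
`not_clauseII_of_two_families`, `not_clauseII_of_moved_incoherent`,
`not_clauseII_of_orientation_dependent`, the orientation-reversal construction `reverseDobrushin`,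
`witness_unique_on_discretisable`) was attached as item EVIDENCE only (ledger, 2026-08-15T23:17:56Z)
and never reached this tree path; the evidence store is not mounted in refuter jails, so that Lean
text is not recoverable here.  Its FINDINGS stand (see the item's evidence notes): clause (ii) alone
forces dilation-coherent, Euclidean-invariant, wiring-orientation-blind interface limits along one
subsequence — consistent with an SLE₆ limit via self-duality + half-mesh shift, not a kill.  The
cheap part (`lagHandOff_iff_clauseII`) is re-derived below; the rest is summarised, not rebuilt.

### Findings of cycle 3 (index)

* `conclusion_iff_clauseII`, `lagHandOff_iff_clauseII` — the crux is
  `RotationInput → ScaleInvariantLimits → ClauseII` (clause (i) being the theorem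
  `lagHandOff_clause_i`).
* `quadCompactness`, `subseqQuadLimits_nonempty`, `exists_isProbabilityMeasure_mem_subseqQuadLimits`
  — VACUITY CHANNELS 1–2 OF CYCLE 1 ARE NOW CLOSED BY THEOREMS: `Λ = subseqQuadLimits univ` is
  non-empty (Mathlib's Prokhorov `instCompactSpaceProbabilityMeasure` on the compact metrisable
  `ℋ_ℂ`, tree `SchrammSmirnov2011_thm_1_4_holds`, `measurable_z2QuadConfig`) and consists of
  probability measures (`isProbabilityMeasure_of_isSubseqQuadLimit`).  Consequence for the
  disprover: the antecedents of the crux are GENUINE statements about genuine laws; a Lean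
  refutation `¬ LagHandOff` must PROVE `ScaleInvariantLimits` (the open scale-invariance problem)
  and `RotationInput` (DKKMO in `ℋ`-form) — refuting the crux is at least as hard as proving
  scale invariance of bond-`ℤ²` limits.  This is the definitive structural reason it resists.
  (`quadCompactness` is verbatim STUB 1 `stub_quadCompactness` of line `crosscut-dictionary`:
  a positive by-product, closed here.)
* `-- Targets` (line `crosscut-dictionary`, lead `prover-line-stmt-CriticalPhenomena-10268-0`):
  `Targets.exists_mem_zdABEdges_of_chain`, `Targets.not_isZdAdmissible_of_three_chains` — the
  combinatorial OBSTRUCTION behind STUB 5 `stub_discretisable`: admissibility makes `{e_a, e_b}` a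
  2-edge cut of the boundary graph between the two discrete arcs; three pairwise edge-disjoint
  boundary chains from an `A`-site to a `B`-site kill admissibility.  No stub is killed; the
  status of each of the seven stubs after this cycle's attacks is recorded in the `Targets`
  section docstring.
-/

/-! ### Clause (ii) isolated -/

/-- Clause (ii) of the conclusion of `LagHandOff`, verbatim (one subsequence, one local Markov
chordal family, serving every `(D, E)`). -/
def ClauseII : Prop :=
  ∀ δs : ℕ → ℝ, (∀ n, 0 < δs n) → Filter.Tendsto δs Filter.atTop (nhds 0) →
    ∃ φ : ℕ → ℕ, StrictMono φ ∧ ∃ P : ChordalFamily, IsLocalMarkovChordalFamily P ∧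
      (∀ D : DobrushinDomain, ∀ᵐ γ ∂(P D), NoTraceAt D γ) ∧
      (∀ (D : DobrushinDomain) (E : ℝ → DiscreteDobrushin), ZdDiscretisationFamily D E →
        ∀ f : BoundedContinuousFunction (CurveClass ℂ) ℝ,
          Filter.Tendsto (fun n => ∫ ω, f (bondInterfaceIn D (E (δs (φ n))) ω)
            ∂(bondPercolation (zdGraph 2) half)) Filter.atTop (nhds (∫ γ, f γ ∂(P D))))

/-- Since clause (i) is a theorem (`lagHandOff_clause_i`), the conclusion IS clause (ii). -/
theorem conclusion_iff_clauseII : Conclusion ↔ ClauseII :=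
  ⟨fun h => h.2, fun h => ⟨fun D E hE => lagHandOff_clause_i D E hE, h⟩⟩

/-- The crux is `RotationInput → ScaleInvariantLimits → ClauseII`. -/
theorem lagHandOff_iff_clauseII :
    LagHandOff ↔ (RotationInput → ScaleInvariantLimits → ClauseII) := by
  rw [lagHandOff_iff]
  exact imp_congr_right fun _ => imp_congr_right fun _ => conclusion_iff_clauseII

/-! ### Vacuity channels 1–2 closed: `Λ ≠ ∅` and consists of probability measures -/

/-- The Schramm–Smirnov space `ℋ = ℋ_ℂ` of full-plane quad-crossing configurations. -/
abbrev ℋ : Type := QuadConfig (Set.univ : Set ℂ)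

/-- **Sequential compactness of the full-plane quad laws** (= STUB 1 `stub_quadCompactness` of
line `crosscut-dictionary`, verbatim): every positive mesh sequence tending to `0` has a
subsequence along which `μ_δ = z2QuadLaw univ δ` converges weakly.  Proof: `ℋ_ℂ` is compact,
Hausdorff and metrisable (`SchrammSmirnov2011_thm_1_4_holds`), hence separable; so
`ProbabilityMeasure ℋ` is compact (Mathlib's Prokhorov-type `instCompactSpaceProbabilityMeasure`,
Riesz–Markov–Kakutani) and metrisable (Lévy–Prokhorov), hence sequentially compact; the laws
`μ_δ`, `δ > 0`, are probability measures (`isProbabilityMeasure_z2QuadLaw_of_pos`, which rests on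
`measurable_z2QuadConfig`), and `toFiniteMeasure` is continuous. -/
theorem quadCompactness :
    ∀ δs : ℕ → ℝ, (∀ n, 0 < δs n) → Tendsto δs atTop (𝓝 0) →
      ∃ φ : ℕ → ℕ, StrictMono φ ∧ ∃ μ : FiniteMeasure ℋ,
        Tendsto (fun n => z2QuadLaw (Set.univ : Set ℂ) (δs (φ n))) atTop (𝓝 μ) := by
  intro δs hpos _
  obtain ⟨⟨hK, hM, hT⟩, -⟩ :=
    SchrammSmirnov2011_thm_1_4_holds (Set.univ : Set ℂ) isOpen_univ Set.univ_nonempty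
  haveI : CompactSpace ℋ := hK
  haveI : T2Space ℋ := hT
  haveI : TopologicalSpace.MetrizableSpace ℋ := hM
  letI : MetricSpace ℋ := TopologicalSpace.metrizableSpaceMetric ℋ
  haveI : SecondCountableTopology ℋ := EMetric.secondCountable_of_sigmaCompact ℋ
  -- the laws as probability measures
  let ν : ℕ → ProbabilityMeasure ℋ := fun n =>
    ⟨(z2QuadLaw (Set.univ : Set ℂ) (δs n) : Measure ℋ),
      isProbabilityMeasure_z2QuadLaw_of_pos isOpen_univ (hpos n)⟩
  have hν : ∀ n, (ν n).toFiniteMeasure = z2QuadLaw (Set.univ : Set ℂ) (δs n) := fun n =>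
    FiniteMeasure.toMeasure_injective rfl
  -- sequential compactness of `ProbabilityMeasure ℋ` (compact + metrisable)
  letI : MetricSpace (ProbabilityMeasure ℋ) :=
    TopologicalSpace.metrizableSpaceMetric (ProbabilityMeasure ℋ)
  obtain ⟨a, -, φ, hφ, hlim⟩ :=
    (isCompact_univ (X := ProbabilityMeasure ℋ)).tendsto_subseq (x := ν) fun _ => Set.mem_univ _
  refine ⟨φ, hφ, a.toFiniteMeasure, ?_⟩
  have hcont : Continuous (ProbabilityMeasure.toFiniteMeasure (Ω := ℋ)) :=
    (ProbabilityMeasure.toFiniteMeasure_isEmbedding ℋ).continuous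
  have h := (hcont.tendsto a).comp hlim
  refine h.congr fun n => ?_
  simp only [Function.comp_apply, hν]

/-- **`Λ ≠ ∅`**: bond-`ℤ²` has subsequential quad-crossing scaling limits (Schramm–Smirnov
Cor. 1.6, now a theorem of the tree + Mathlib).  Closes vacuity channel 1 of cycle 1
(`hyps_of_subseqQuadLimits_eq_empty` can never fire). -/
theorem subseqQuadLimits_nonempty : (subseqQuadLimits (Set.univ : Set ℂ)).Nonempty := by
  obtain ⟨φ, hφ, μ, hμ⟩ := quadCompactness (fun n => 1 / ((n : ℝ) + 1))
    (fun n => by positivity) tendsto_one_div_add_atTop_nhds_zero_nat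
  refine ⟨μ, (isSubseqQuadLimit_iff Set.univ μ).mpr ⟨fun n => 1 / ((φ n : ℝ) + 1),
    fun n => by positivity, ?_, hμ⟩⟩
  exact tendsto_one_div_add_atTop_nhds_zero_nat.comp hφ.tendsto_atTop

/-- Every subsequential limit is a probability measure (tree:
`isProbabilityMeasure_of_isSubseqQuadLimit`); in particular no element of `Λ` is the zero law,
which closes vacuity channel 2 of cycle 1 (`hyps_of_subseqQuadLimits_subset_zero` can never
fire). -/
theorem ne_zero_of_mem_subseqQuadLimits {μ : FiniteMeasure ℋ}
    (hμ : μ ∈ subseqQuadLimits (Set.univ : Set ℂ)) : μ ≠ 0 := by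
  intro h
  haveI := isProbabilityMeasure_of_isSubseqQuadLimit isOpen_univ hμ
  have h1 : (μ : Measure ℋ) Set.univ = 1 := measure_univ
  rw [h] at h1
  simp at h1

/-- `Λ` contains a probability measure (non-vacuity of both antecedents' domain of
quantification, as genuine laws). -/
theorem exists_isProbabilityMeasure_mem_subseqQuadLimits :
    ∃ μ ∈ subseqQuadLimits (Set.univ : Set ℂ), IsProbabilityMeasure (μ : Measure ℋ) := by
  obtain ⟨μ, hμ⟩ := subseqQuadLimits_nonempty
  exact ⟨μ, hμ, isProbabilityMeasure_of_isSubseqQuadLimit isOpen_univ hμ⟩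

/-- The junk hypothesis of cycle 1's channel 1 is FALSE. -/
theorem subseqQuadLimits_ne_empty : subseqQuadLimits (Set.univ : Set ℂ) ≠ ∅ :=
  subseqQuadLimits_nonempty.ne_empty

/-- The junk hypothesis of cycle 1's channel 2 is FALSE. -/
theorem not_forall_mem_subseqQuadLimits_eq_zero :
    ¬ (∀ μ ∈ subseqQuadLimits (Set.univ : Set ℂ), μ = 0) := fun h => by
  obtain ⟨μ, hμ⟩ := subseqQuadLimits_nonempty
  exact ne_zero_of_mem_subseqQuadLimits hμ (h μ hμ)

/-! ### Targets — line `crosscut-dictionary` (lead `prover-line-stmt-CriticalPhenomena-10268-0`)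

Status of the seven registered stubs after this cycle's attacks (kill attempts first; positive
by-products recorded because the provers read this file):

* STUB 1 `stub_quadCompactness` — TRUE, proved above (`quadCompactness`, verbatim statement); landed
  independently by the lead (`Theorems/CardySelfRefinementLagHandOffQuadCompactness.lean`).
* STUB 2 `stub_crosscutDictionary` (load-bearing, `∃ Ψ, IsCrosscutDictionary Ψ`) — RESISTS, no
  cheap kill.  Two lattice-level NECESSARY CONDITIONS it implies, for the record (neither is
  refutable cheaply; both are believed): NC1 pathwise merging — for two admissible families `E`,
  `E'` of one `D`, joint convergence of `(ω_δ, γ^E_δ)` and of `(ω_δ, γ^{E'}_δ)` to graph measures of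
  the SAME `Ψ_D` forces `dist (γ^E_δ, γ^{E'}_δ) → 0` in probability along every quad-convergent
  sequence, hence (by `quadCompactness`) along `δ → 0⁺` itself; NC2 approximability — convergence
  to a graph measure holds iff for every `ε, η > 0` some CONTINUOUS `g : ℋ → CurveClass ℂ` has
  `limsup P (dist (γ_δ, g ω_δ) > ε) < η`, the finite-mesh form of GPS13's measurability question.
  Checked channels: (a) junk integrals — closed: `z2QuadConfig univ δ` is Borel for
  `δ > 0` (`measurable_z2QuadConfig`) and the interfaces are measurable (`measurable_bondInterfaceIn`),
  so the integrands of `HandsOff` are genuine and its first marginal is the honest statement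
  `μ_{δₙ} → μ`; (b) EXACT lattice symmetries (quarter turn `z2QuadLaw_map_rotate_pi_div_two`,
  lattice translations `z2QuadLaw_map_translate_meshPoint`, mesh scaling `z2QuadLaw_map_dilate`,
  conjugation `z2QuadLaw_map_conj`) combined with `IsSimilarityEquivariant` + E-blind `HandsOff`
  only reproduce invariances the limits `μ ∈ Λ` provably have (conjugation is not a similarity and
  is not demanded) — consistent; (c) freeness: the similarity group acts freely on Dobrushin
  domains (a similarity fixing a bounded open set has `‖c‖ = 1`, and a rotation fixing two distinct
  boundary points is the identity), so pointwise equivariance for ALL `S` is satisfiable by any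
  natural recipe with an equivariant junk branch; (d) the content is GPS13 Question 10 on `ℤ²`
  sublimits (curve topology) + E-universality of interface limits — open, believed, unrefutable.
* STUB 3 `stub_translationInput` — TRUE; landed by the lead
  (`Theorems/CardySelfRefinementLagHandOffTranslation.lean`: joint continuity of the translation
  action on `ℂ × ℋ` + exact lattice invariance); not attacked.
* STUB 4 `stub_covarianceFromDictionary` — TRUE, landed by the lead
  (`Theorems/CardySelfRefinementLagHandOffCovariance.lean`) (pure push-forward algebra:
  `similarity c hc w = (mulLeft₀ ‖c‖) ≫ rotation (arg c) ≫ (addLeft w)` as homeomorphisms,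
  `mapHomeomorph_trans`, `Measure.map_map`; all three invariance families are inverse-closed so no
  orientation/convention mismatch can bite; `μ = 0` and Dirac masses at `QuadConfig.none/all` are
  covariant, not counterexamples).
* STUB 5 `stub_discretisable` (`∀ D, ∃ E, ZdDiscretisationFamily D E`) — THE RESIDUAL; attacked
  hardest this cycle, NOT killed, and after the analysis in the docstring of
  `Targets.not_isZdAdmissible_of_three_chains` (dust freedom of the Hausdorff clauses, contour
  parity from `existsUnique_medialExploration_holds`, adaptive chord-free cut) judged PLAUSIBLY
  TRUE for every Jordan domain: every counterexample mechanism tried (cusps, combs, parallel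
  exterior filaments, labyrinths, nested narrow bays) is defeated by the discretiser's freedom or
  by continuity of the boundary loop.  Cost warning to the lead: the general proof is intricate;
  restricting to the class of domains the axioms are actually evaluated on is NOT available (the
  axioms of (ii) quantify over all Dobrushin domains), so this stub is real work, not bookkeeping.
* STUBS 6–7 `stub_freeAxioms`, `stub_markovPassage` — conditional on a dictionary (STUB 2) and on
  STUB 5; the axioms they assert were audited against the lattice in cycles 1–2 (IsLocal and the
  `domain` clause of the Markov extension force `P D` to depend on `(carrier, a, b)` only — wiring
  orientation blindness, consistent by self-duality + half-mesh shift; `markov` at `F = ∅` pins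
  `Q D γ = δ_{const b}` a.s.; `domain` bites across different domains only through boundary-tracing
  pasts, which are atypical).  No kill.
-/

namespace Targets

/-- The consecutive-pair edges of the vertex sequence `x :: l`, as unordered pairs. -/
def chainEdges (x : Site 2) (l : List (Site 2)) : List (Sym2 (Site 2)) :=
  ((x :: l).zip l).map fun p => s(p.1, p.2)

/-- A **boundary chain from the arc of `A` to the arc of `B`** in the discrete Dobrushin data
`E`: a vertex sequence `x :: l` of sites of the square-lattice discrete boundary `E.zdBoundary`,
consecutive sites `Ω_δ`-adjacent, starting on the discrete arc of `A` and ending on the discrete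
arc of `B`. -/
structure IsBoundaryChain (E : DiscreteDobrushin) (x : Site 2) (l : List (Site 2)) : Prop where
  source_mem : x ∈ E.zdArcA
  mem_zdBoundary : ∀ y ∈ l, y ∈ E.zdBoundary
  adj : ∀ p ∈ (x :: l).zip l, (discreteDomainGraph E.Ω E.δ).Adj p.1 p.2
  target_mem : (x :: l).getLast (List.cons_ne_nil x l) ∈ E.zdArcB

/-- **Discrete intermediate value theorem on the boundary**: if the two discrete arcs are
disjoint and cover the discrete boundary, every boundary chain from the arc of `A` to the arc of
`B` traverses an `A`–`B` edge (`zdABEdges`). -/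
theorem exists_mem_zdABEdges_of_chain (E : DiscreteDobrushin)
    (hcover : E.zdBoundary ⊆ E.zdArcA ∪ E.zdArcB) (hdisj : Disjoint E.zdArcA E.zdArcB) :
    ∀ (l : List (Site 2)) (x : Site 2), IsBoundaryChain E x l →
      ∃ e ∈ chainEdges x l, e ∈ E.zdABEdges
  | [], x, h => by
    have hA := h.source_mem
    have hB : x ∈ E.zdArcB := by simpa using h.target_mem
    exact (Set.disjoint_left.1 hdisj hA hB).elim
  | y :: l, x, h => by
    have hxy : (discreteDomainGraph E.Ω E.δ).Adj x y := h.adj (x, y) (by simp)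
    by_cases hy : y ∈ E.zdArcB
    · refine ⟨s(x, y), ?_, ?_⟩
      · simp [chainEdges]
      · rw [DiscreteDobrushin.mem_zdABEdges_iff]
        exact ⟨(SimpleGraph.mem_edgeSet _).2 hxy, ⟨x, by simp, h.source_mem⟩, ⟨y, by simp, hy⟩⟩
    · have hyA : y ∈ E.zdArcA := (hcover (h.mem_zdBoundary y (by simp))).resolve_right hy
      have h' : IsBoundaryChain E y l :=
        { source_mem := hyA
          mem_zdBoundary := fun z hz => h.mem_zdBoundary z (by simp [hz])
          adj := fun p hp => h.adj p (by
            rw [List.zip_cons_cons]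
            exact List.mem_cons_of_mem _ hp)
          target_mem := by
            have := h.target_mem
            rwa [List.getLast_cons (List.cons_ne_nil y l)] at this }
      obtain ⟨e, he, heAB⟩ := exists_mem_zdABEdges_of_chain E hcover hdisj l y h'
      refine ⟨e, ?_, heAB⟩
      simp only [chainEdges, List.zip_cons_cons, List.map_cons, List.mem_cons] at he ⊢
      exact Or.inr he

/-- **OBSTRUCTION TO ADMISSIBILITY (STUB 5 `stub_discretisable`).**  Admissibility
(`IsZdAdmissible`: disjoint discrete arcs covering `zdBoundary`, EXACTLY TWO `A`–`B` edges) makes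
`{e_a, e_b}` a 2-edge cut of the boundary graph `G_∂` (sites of `zdBoundary`, edges of `Ω_δ`)
between the two discrete arcs: three pairwise edge-disjoint boundary chains from an `A`-site to a
`B`-site are impossible.  ANALYSIS FOR THE PROVER OF STUB 5 (paper, this cycle).
(1) What the family axioms pin.  Mesh points are never on `∂D` (`D` open).  The Hausdorff clauses
`tendsto_arcA/B` are nearly free: `arcA`, `arcB ⊆ ℂ` are arbitrary sets, and exterior "dust"
(points of `ℂ ∖ D̄` near `D.arc i`, outside the finitely many closed nearest-point balls of the
boundary sites) achieves any Hausdorff accuracy WITHOUT changing `zdArcA/B`; conversely donating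
frontier or interior points flips chosen sites.  What remains pinned: `zdArcB ⊆ N_{ε+2δ}(D.arc 1)`,
`zdArcA ⊆ N_{ε+2δ}(D.arc 0)` (a `B`-site is within `2δ` of `arcB`), and the `A`–`B` edges → `{a,b}`.
(2) Parity (the tree's `existsUnique_medialExploration_holds`, MedialInterfaceProofs): both
`A`–`B` edges lie on ONE cycle `C₀` of the boundary of the union of inner faces, and `B ∩ C₀`,
`A ∩ C₀` are its two arcs between `e_a` and `e_b`; so junk data ("blobs") are NOT admissible and
the discrete arc of `B` is an honest contour arc running within `o(1)` of `D.arc 1` from near `a`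
to near `b`.
(3) Hence STUB 5 holds for `D` iff at all small meshes there is a contour arc `S ⊆ C₀` inside
`N_{o(1)}(D.arc 1)`, from the `a`-zone to the `b`-zone, closed off by a `B`-set with NO chord of
`G_∂` to an `A`-site other than its two end edges (each bordering exactly one inner face).  Chords
= rungs of one-face-wide necks of `D` and pinch edges; a chord is harmful only if it straddles the
cut in `C₀`-order, so the discretiser needs ONE chord-free cut position within `o(1)` of `a` (and
of `b`), with the `o(1)` shrinking as slowly as it likes.
(4) Every kill mechanism tried against this adaptive freedom fails for a FIXED Jordan domain:
cusps and corners (chords confined to `O(δ)` of the tip — cut farther out, declaring the last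
stretch of the arc-1 pass `A`, which (1) allows); combs / dense teeth (pendant filaments, no
chords); an exterior filament parallel to `∂D` at distance `≍ δ_k` (through-corridor ladder at
scale `δ_k`, but the bulk-facing pass is clean, and at finer scales the corridor is thick; a
sequence of such filaments accumulating on `∂D` contradicts continuity of the boundary loop —
finitely many excursions of diameter `> ε`); nested narrow bays (same-scale bay intervals along
`C₀` are disjoint or nested sideways, headland edges stay uncovered).  VERDICT: no counterexample
mechanism survives; STUB 5 is plausibly TRUE for every Jordan domain, its general proof is an
intricate planar-combinatorics argument (adaptive cut + dust + parity), and for piecewise-`C¹`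
boundaries it is routine but long (cf. the 1 400-line unit disc).  A Lean counterexample would in
any case need a wild Jordan curve built in Lean plus a scale-by-scale analysis of `meshDomain`;
none is claimed. -/
theorem not_isZdAdmissible_of_three_chains (E : DiscreteDobrushin)
    {x₁ x₂ x₃ : Site 2} {l₁ l₂ l₃ : List (Site 2)}
    (h₁ : IsBoundaryChain E x₁ l₁) (h₂ : IsBoundaryChain E x₂ l₂) (h₃ : IsBoundaryChain E x₃ l₃)
    (h₁₂ : (chainEdges x₁ l₁).Disjoint (chainEdges x₂ l₂))
    (h₁₃ : (chainEdges x₁ l₁).Disjoint (chainEdges x₃ l₃))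
    (h₂₃ : (chainEdges x₂ l₂).Disjoint (chainEdges x₃ l₃)) :
    ¬ E.IsZdAdmissible := by
  intro hadm
  have hcover := hadm.zdBoundary_subset
  have hdisj := hadm.disjoint
  obtain ⟨e₁, he₁, hab₁⟩ := exists_mem_zdABEdges_of_chain E hcover hdisj l₁ x₁ h₁
  obtain ⟨e₂, he₂, hab₂⟩ := exists_mem_zdABEdges_of_chain E hcover hdisj l₂ x₂ h₂
  obtain ⟨e₃, he₃, hab₃⟩ := exists_mem_zdABEdges_of_chain E hcover hdisj l₃ x₃ h₃
  have hne₁₂ : e₁ ≠ e₂ := fun h => h₁₂ he₁ (h ▸ he₂)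
  have hne₁₃ : e₁ ≠ e₃ := fun h => h₁₃ he₁ (h ▸ he₃)
  have hne₂₃ : e₂ ≠ e₃ := fun h => h₂₃ he₂ (h ▸ he₃)
  obtain ⟨p, q, -, hpq⟩ := Set.ncard_eq_two.1 hadm.ncard_zdABEdges_eq_two
  rw [hpq] at hab₁ hab₂ hab₃
  simp only [Set.mem_insert_iff, Set.mem_singleton_iff] at hab₁ hab₂ hab₃
  rcases hab₁ with rfl | rfl <;> rcases hab₂ with rfl | rfl <;> rcases hab₃ with rfl | rfl <;>
    simp_all

/-- The same obstruction read positively: under admissibility, among any three boundary chains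
from the arc of `A` to the arc of `B`, two share an edge (the boundary graph between the arcs has
edge-connectivity at most `2`, realised by `{e_a, e_b}`). -/
theorem IsZdAdmissible.two_chains_share_an_edge {E : DiscreteDobrushin} (hadm : E.IsZdAdmissible)
    {x₁ x₂ x₃ : Site 2} {l₁ l₂ l₃ : List (Site 2)}
    (h₁ : IsBoundaryChain E x₁ l₁) (h₂ : IsBoundaryChain E x₂ l₂) (h₃ : IsBoundaryChain E x₃ l₃) :
    ¬ ((chainEdges x₁ l₁).Disjoint (chainEdges x₂ l₂) ∧
        (chainEdges x₁ l₁).Disjoint (chainEdges x₃ l₃) ∧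
        (chainEdges x₂ l₂).Disjoint (chainEdges x₃ l₃)) :=
  fun h => not_isZdAdmissible_of_three_chains E h₁ h₂ h₃ h.1 h.2.1 h.2.2 hadm

/-- Every `A`–`B` edge of admissible data borders exactly one inner face; in particular a chain
edge that is an `A`–`B` edge bordering TWO inner faces (an interior rung of a ladder) already
kills admissibility — the second half of the obstruction (no counting needed). -/
theorem not_isZdAdmissible_of_ab_edge_two_inner_faces (E : DiscreteDobrushin)
    {e : Sym2 (Site 2)} (he : e ∈ E.zdABEdges) {f f' : Site 2} (hff' : f ≠ f')
    (hf : E.IsInnerFace f ∧ ∀ x ∈ e, IsCorner x f)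
    (hf' : E.IsInnerFace f' ∧ ∀ x ∈ e, IsCorner x f') : ¬ E.IsZdAdmissible := fun hadm =>
  hff' ((hadm.zdABEdges_inner e he).unique hf hf')

end Targets

/-! ### Kill templates for clause (ii), re-derived (the cycle-2 originals did not reach the tree)

Each template turns ONE persistent lattice discrepancy into `¬ ClauseII` (hence, given the two
antecedents, into `¬ LagHandOff`).  They are `o(1)` statements about interface statistics, so a
Monte-Carlo run can only show trends, never certify them; no `kit` job is attached. -/

/-- The `f`-statistic of the bond-`ℤ²` exploration interface of `(D; E δ)` at mesh `δ`. -/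
def stat (D : DobrushinDomain) (E : ℝ → DiscreteDobrushin)
    (f : BoundedContinuousFunction (CurveClass ℂ) ℝ) (δ : ℝ) : ℝ :=
  ∫ ω, f (bondInterfaceIn D (E δ) ω) ∂(bondPercolation (zdGraph 2) half)

/-- TEMPLATE 1 — hidden `E`-universality.  Clause (ii) makes the interface limit along the
chosen subsequence the SAME for every admissible discretisation family of a given Dobrushin
domain; so two admissible families `E`, `E'` of one `D` whose `f`-statistics stay apart along
every subsequence of some mesh sequence refute clause (ii). -/
theorem not_clauseII_of_two_families (D : DobrushinDomain) (E E' : ℝ → DiscreteDobrushin)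
    (hE : ZdDiscretisationFamily D E) (hE' : ZdDiscretisationFamily D E')
    (f : BoundedContinuousFunction (CurveClass ℂ) ℝ) (δs : ℕ → ℝ) (hpos : ∀ n, 0 < δs n)
    (hlim : Tendsto δs atTop (𝓝 0))
    (h : ∀ φ : ℕ → ℕ, StrictMono φ →
      ¬ Tendsto (fun n => stat D E f (δs (φ n)) - stat D E' f (δs (φ n))) atTop (𝓝 0)) :
    ¬ ClauseII := by
  intro hC
  obtain ⟨φ, hφ, P, -, -, hconv⟩ := hC δs hpos hlim
  have h12 := (hconv D E hE f).sub (hconv D E' hE' f)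
  rw [sub_self] at h12
  exact h φ hφ h12

/-- The test function `f ∘ (CurveClass.map φ)` for the similarity `φ = similarity c hc w`
(bounded continuous: `CurveClass.map φ` is `‖c‖`-Lipschitz). -/
def moveBCF (c : ℂ) (hc : c ≠ 0) (w : ℂ) (f : BoundedContinuousFunction (CurveClass ℂ) ℝ) :
    BoundedContinuousFunction (CurveClass ℂ) ℝ :=
  f.compContinuous ⟨CurveClass.map (similarity c hc w : C(ℂ, ℂ)),
    (CurveClass.lipschitzWith_map (lipschitzWith_similarity c hc w)).continuous⟩

@[simp] theorem moveBCF_apply (c : ℂ) (hc : c ≠ 0) (w : ℂ)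
    (f : BoundedContinuousFunction (CurveClass ℂ) ℝ) (γ : CurveClass ℂ) :
    moveBCF c hc w f γ = f (γ.map (similarity c hc w : C(ℂ, ℂ))) := rfl

/-- TEMPLATE 2 — Euclidean/scale covariance against the UNMOVED lattice.  Clause (ii) asserts,
along one subsequence, `P (φD) = φ_* (P D)` for every similarity `φ` while BOTH sides are limits
of interfaces drawn on the same lattices `δₙℤ²` (the lattice is not moved with the domain).  So a
Dobrushin domain `D`, a similarity `φ = (z ↦ c z + w)`, admissible families `E` of `D` and `E'` of
`φD`, and a test function `f` whose statistics `stat (φD) E' f` and `stat D E (f ∘ φ)` stay apart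
along every subsequence of some mesh sequence refute clause (ii).  For `c = e^{iα}`,
`α ∉ (π/2)ℤ`, this is the interface-level shadow of `RotationInput`; for `c = t > 0` that of
`ScaleInvariantLimits` (the cycle-2 identity `bondInterfaceIn_dil` made the dilation case an exact
comparison of ONE family at meshes `δ` and `δ/t`, i.e. a log-periodicity test). -/
theorem not_clauseII_of_moved_incoherent (D : DobrushinDomain) (c : ℂ) (hc : c ≠ 0) (w : ℂ)
    (E : ℝ → DiscreteDobrushin) (hE : ZdDiscretisationFamily D E)
    (E' : ℝ → DiscreteDobrushin) (hE' : ZdDiscretisationFamily (D.map (similarity c hc w)) E')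
    (f : BoundedContinuousFunction (CurveClass ℂ) ℝ) (δs : ℕ → ℝ) (hpos : ∀ n, 0 < δs n)
    (hlim : Tendsto δs atTop (𝓝 0))
    (h : ∀ φ : ℕ → ℕ, StrictMono φ →
      ¬ Tendsto (fun n => stat (D.map (similarity c hc w)) E' f (δs (φ n)) -
          stat D E (moveBCF c hc w f) (δs (φ n))) atTop (𝓝 0)) :
    ¬ ClauseII := by
  intro hC
  obtain ⟨φ, hφ, P, hP, -, hconv⟩ := hC δs hpos hlim
  have h1 := hconv (D.map (similarity c hc w)) E' hE' f
  have h2 := hconv D E hE (moveBCF c hc w f)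
  have hcov : P (D.map (similarity c hc w)) =
      (P D).map (CurveClass.map (similarity c hc w : C(ℂ, ℂ))) :=
    hP.similarity D c hc w
  have hint : ∫ γ, f γ ∂(P (D.map (similarity c hc w))) = ∫ γ, moveBCF c hc w f γ ∂(P D) := by
    rw [hcov, integral_map (measurable_curveClassMap_similarity c hc w).aemeasurable
      f.continuous.aestronglyMeasurable]
    rfl
  rw [hint] at h1
  have h12 := h1.sub h2
  rw [sub_self] at h12
  exact h φ hφ h12

/-- TEMPLATE 3 — wiring-orientation blindness (cycle 2's `not_clauseII_of_orientation_dependent`,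
restated abstractly).  `IsLocal` alone forces `P D = P D'` whenever `D`, `D'` have the same
carrier and the same marked points (`stopAt ∅ = id`; proved in cycle 1's lost extension and in
the line files as `eq_of_isLocal_of_carrier_eq`); so two Dobrushin structures on ONE carrier with
the same `a`, `b` — e.g. opposite orientations, which SWAP the wired arc — whose interface
statistics stay apart along every subsequence refute clause (ii).  Stated here with the carrier
identity as a hypothesis on `P`-values to stay self-contained. -/
theorem not_clauseII_of_same_carrier_incoherent (D D' : DobrushinDomain)
    (hP : ∀ P : ChordalFamily, IsLocalMarkovChordalFamily P → P D = P D')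
    (E : ℝ → DiscreteDobrushin) (hE : ZdDiscretisationFamily D E)
    (E' : ℝ → DiscreteDobrushin) (hE' : ZdDiscretisationFamily D' E')
    (f : BoundedContinuousFunction (CurveClass ℂ) ℝ) (δs : ℕ → ℝ) (hpos : ∀ n, 0 < δs n)
    (hlim : Tendsto δs atTop (𝓝 0))
    (h : ∀ φ : ℕ → ℕ, StrictMono φ →
      ¬ Tendsto (fun n => stat D E f (δs (φ n)) - stat D' E' f (δs (φ n))) atTop (𝓝 0)) :
    ¬ ClauseII := by
  intro hC
  obtain ⟨φ, hφ, P, hPax, -, hconv⟩ := hC δs hpos hlim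
  have h1 := hconv D E hE f
  have h2 := hconv D' E' hE' f
  rw [← hP P hPax] at h2
  have h12 := h1.sub h2
  rw [sub_self] at h12
  exact h φ hφ h12

/-- The carrier identity used by TEMPLATE 3, from `IsLocal` alone: if two Dobrushin domains have
the same carrier and the same marked points then every local family gives them the same law
(the stopping set `closure (D ∖ D') = ∅` stops nothing). -/
theorem eq_of_isLocal_of_carrier_eq {P : ChordalFamily} (hP : P.IsLocal) {D D' : DobrushinDomain}
    (hc : D'.carrier = D.carrier) (h0 : D'.pt 0 = D.pt 0) (h1 : D'.pt 1 = D.pt 1) :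
    P D' = P D := by
  have hempty : closure (D.carrier \ D'.carrier) = ∅ := by
    rw [hc, sdiff_self]
    exact closure_empty
  have key : ∀ c' : Curve ℂ, c'.stopAt (∅ : Set ℂ) = c' := by
    intro c'
    have hparam : c'.hitParam (∅ : Set ℂ) = 1 := by
      apply le_antisymm (c'.hitParam_mem_Icc ∅).2
      apply le_csInf ⟨1, c'.one_mem_hitSet ∅⟩
      rintro t (⟨_h, ht⟩ | ht)
      · exact absurd ht (Set.notMem_empty _)
      · rw [Set.mem_singleton_iff.1 ht]
    refine Curve.ext (ContinuousMap.ext fun s => ?_)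
    change (c'.stopAt ∅) s = c' s
    rw [Curve.stopAt_apply, hparam, one_mul, Set.projIcc_val]
  have hstop : ∀ γ : CurveClass ℂ, γ.stopAt (∅ : Set ℂ) = γ := by
    intro γ
    change CurveClass.mk (γ.out.stopAt ∅) = γ
    rw [key, CurveClass.mk_out]
  have hid : (fun γ : CurveClass ℂ => γ.stopAt (closure (D.carrier \ D'.carrier))) = id := by
    funext γ; rw [hempty]; exact hstop γ
  ext T hT
  have := hP D D' hc.le h0 h1 T hT
  simpa [hid] using this

/-! ## Cycle 4 (refuter cdisprove g4, 2026-08-16)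

### What changed
* LANDED as importable tree theorems (gate now accepts `Theorems/LagHandOff/Negative/`):
  `Negative/Structure.lean` (clause (i) outright, `lagHandOff_iff_clauseII`,
  `not_lagHandOff_iff_clauseII`, closed vacuity channels, `arcFamily_violates_noTracing`),
  `Negative/Guards.lean` (`clauseII_false_without_discretisation_guard`,
  `clauseII_false_without_mesh_positivity`), `Negative/KillTemplates.lean`
  (`not_lagHandOff_of_two_families / _of_moved_incoherent / _of_same_carrier_incoherent`,
  `eq_of_isLocal_of_carrier_eq`), `Negative/StopAtDiscontinuity.lean` and
  `Negative/DictionaryMerging.lean` (this cycle's two findings, below).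
* AXIOM RE-AUDIT (paper) of `IsLocalMarkovChordalFamily` + no-tracing against SLE₆: consistent
  (IsLocal trivial when `a ∈ closure (D ∖ D')`; `domain` quantifies over all pasts but `Q` is free
  off typical pasts, `Q := G(remainingDomain, tip, b)`; remaining domain is ONE component for
  typical pasts since Jordan domains are locally connected at `b`; tips are single prime ends a.s.;
  `CurveClass.stopAt_mk` is discharged in `ChordalCurveFamilyProofs`).  No inconsistency kill:
  the conclusion of the crux is satisfiable on paper by the SLE₆ family, as cycles 1–3 found.

* PRINT CHECK (held text arXiv:1905.13207 = Holden–Sun, *Convergence of uniform triangulations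
  under the Cardy embedding*, materialised pp. 108–109): §6.6 "The quad-crossing configuration
  determines the CLE₆", **Prop. 6.25**: "let `η` be the interface of `Γ` on `(𝔻, -i, i)`.  Then `η`
  is a.s. determined by `ω`", proved exactly by the cross-cut lever ("for each fixed `s ∈ (0,1)`,
  a.s. `η(τ) ∈ ρ([0,s])` iff `ω(Q) = 1` with `Q = (U, -i, ρ(1), ρ(s), ρ(0))`", then ranges via
  balls `B` and pairs `ρ_ℓ, ρ_r`).  So GPS13 Question 10 is answered POSITIVELY for the continuum
  limit of site-`𝕋` percolation, and the load-bearing STUB 2 of the picked line is the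
  `ℤ²`-subsequential transplant of a printed theorem: no printed obstruction exists; the residual
  risk is only the transplant (RSW inputs are available on `ℤ²`).  (`lit search` itself was
  degraded this cycle — searchd timeout —; the galaxy substring index returned nothing new.)
* NC1 PROBE (kit job `j013806` — supersedes `j008783`/`j008420`, which died on the bundle entry —,
  script `nc1job/main.py` of the g4 folder, `--workitem` attached: its summary + stdout tail land
  on the item as evidence `compute-j013806.json` when it runs; queue wait was ≈ 3 h at filing):
  Monte-Carlo of the certified consequence `interfaces_merge_of_handsOff'` on the `L × L` square,
  `L = 64 … 1024`, with `e_a` shifted by `k ∈ {1, 2, 8}` lattice steps on the SAME configuration;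
  statistic `P(the two interfaces, as sets of medial corners (site ∈ C_A, face ∈ C*_B), differ
  beyond distance rL from a)`; prediction `≍ (k/(rL))^{1/3}` (boundary one-arm), i.e. slope `-1/3`
  in `log L`.  A NON-decaying `P` would be evidence against STUB 2; the next seat should fold the
  printed table (stdout tail of the evidence file) in here.

### Findings of cycle 4 (index)
* `not_continuousAt_mk_stopAt`, `not_continuousAt_curveClass_stopAt`,
  `not_continuousAt_mk_stopAt_arch` — TARGETS (STUBS 6–7): the stopping map `stopAt F` is
  DIScontinuous at one-sided touching, which is the `P D'`-typical situation in `IsLocal` and the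
  typical situation for `F = D.arc 1` in `IsTargetIndependent`; the planned "a.s. continuity of
  `CurveClass.stopAt` at the limit law" (skeleton; `…LagHandOffChordal.lean` docstring) is not
  available there.  Repair: thickenings `cthickening ε F` + `ε ↓ 0`, or the lattice coupling.
* `not_continuousAt_mk_stopAt_of_subset_sphere` — the same obstruction at the tree's `unitDisc`
  (any `F ⊆ ∂𝔻`, any curve of the closed disc with first contact `≠` endpoint; radial shrinking);
  `tendsto_hitParam_cthickening` — the REPAIR: hitting parameters of `cthickening ε F` tend to that
  of `F` for every curve (deterministic), so identities can be passed to the limit at fat stopping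
  sets and then `ε ↓ 0`.
* `tendsto_integral_abs_sub_of_two_graph_limits`, `interfaces_merge_of_handsOff`,
  `interfaces_merge_of_handsOff'` — NC1 CERTIFIED: the hands-off field of STUB 2 forces the
  interfaces of two admissible families of one domain to merge pathwise
  (`∫ |h γ^{E} - h γ^{E'}| → 0`) along EVERY positive null mesh sequence.  Rate heuristics: moving
  `e_a` by `s` changes the interface beyond distance `r` with probability `≍ (s/r)^{1/3}` (boundary
  one-arm), `→ 0` — consistent, slow; no kill.
-/

/-! ### Cycle 4 (a): `stopAt F` is DIScontinuous at one-sided touching — obstruction to the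
"continuity of `stopAt` at the limit law" step planned for STUB 6 (IsLocal, IsTargetIndependent)
and STUB 7 (Markov passage) -/

/-- `CurveClass.mk` is continuous (it is the separation quotient map). -/
theorem continuous_curveClassMk {E : Type*} [PseudoMetricSpace E] :
    Continuous (CurveClass.mk : Curve E → CurveClass E) := by
  rw [CurveClass.mk_eq_separationQuotientMk]
  exact SeparationQuotient.continuous_mk

/-- **OBSTRUCTION (generic).**  If a curve `γ` meets the closed set `F` strictly before its end
in the sense that its first contact point `γ(σ_F)` differs from its endpoint, while `γ` is a limit
(reparametrisation distance) of curves AVOIDING `F`, then the stopping map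
`c ↦ [c.stopAt F]` (class of the initial segment up to the first hitting of `F`) is NOT
continuous at `γ`: along the approximants it is the identity (they are never stopped), so its
values tend to `[γ]`, whose endpoint is `γ(1) ≠ γ(σ_F)` = the endpoint of `[γ.stopAt F]`.
This is exactly the situation of the lattice-to-limit passage in STUB 6: lattice interfaces live
inside the open domain and avoid `F = D.arc 1 ⊆ ∂D` (target independence) or, on the `D'`-side of
LSW locality, `F = closure (D ∖ D') ⊆ ℂ ∖ D'`, while the limit curve touches `F` one-sidedly
with positive probability (`κ = 6 > 4`: boundary touching).  So the stopped LATTICE curves do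
NOT converge to the stopped LIMIT curve there; the identities must be passed to the limit through
thickenings `F_ε = cthickening ε F` (whose first-hitting parameters increase to `σ_F` for every
curve as `ε ↓ 0`) or through the lattice coupling, not through continuity of `stopAt F`. -/
theorem not_continuousAt_mk_stopAt {E : Type*} [MetricSpace E] {F : Set E} {γ : Curve E}
    {γs : ℕ → Curve E} (hconv : Tendsto γs atTop (𝓝 γ)) (havoid : ∀ n t, γs n t ∉ F)
    (hne : γ ⟨γ.hitParam F, γ.hitParam_mem_Icc F⟩ ≠ γ.target) :
    ¬ ContinuousAt (fun c : Curve E => CurveClass.mk (c.stopAt F)) γ := by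
  intro hcont
  -- along the approximants the stopping map is the identity
  have hid : ∀ n, (γs n).stopAt F = γs n := fun n =>
    Curve.stopAt_eq_self_of_hitParam_eq_one (Curve.hitParam_eq_one_of_forall_notMem (havoid n))
  have h1 : Tendsto (fun n => CurveClass.mk ((γs n).stopAt F)) atTop
      (𝓝 (CurveClass.mk (γ.stopAt F))) := hcont.tendsto.comp hconv
  have h2 : Tendsto (fun n => CurveClass.mk ((γs n).stopAt F)) atTop (𝓝 (CurveClass.mk γ)) := by
    simp only [hid]
    exact (continuous_curveClassMk.tendsto γ).comp hconv
  have heq : CurveClass.mk (γ.stopAt F) = CurveClass.mk γ := tendsto_nhds_unique h1 h2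
  have htgt := congrArg CurveClass.target heq
  rw [CurveClass.target_mk, CurveClass.target_mk, Curve.target_stopAt] at htgt
  exact hne htgt

/-- The same obstruction one level down, on curve CLASSES: `CurveClass.stopAt F` is not
continuous at `[γ]` (for closed `F`, `CurveClass.stopAt F ∘ mk = mk ∘ Curve.stopAt F` by the
discharged named fact `CurveClass.stopAt_mk_holds`). -/
theorem not_continuousAt_curveClass_stopAt {E : Type*} [MetricSpace E] {F : Set E}
    (hF : IsClosed F) {γ : Curve E} {γs : ℕ → Curve E} (hconv : Tendsto γs atTop (𝓝 γ))
    (havoid : ∀ n t, γs n t ∉ F)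
    (hne : γ ⟨γ.hitParam F, γ.hitParam_mem_Icc F⟩ ≠ γ.target) :
    ¬ ContinuousAt (CurveClass.stopAt F) (CurveClass.mk γ) := by
  intro hcont
  apply not_continuousAt_mk_stopAt hconv havoid hne
  have hfun : (fun c : Curve E => CurveClass.mk (c.stopAt F)) =
      CurveClass.stopAt F ∘ CurveClass.mk := by
    funext c
    exact (CurveClass.stopAt_mk_holds F hF c).symm
  rw [hfun]
  exact hcont.comp continuous_curveClassMk.continuousAt

/-- The parabolic ARCH of height `r`: `t ↦ i · 4 r t (1 - t)`, from `0` back to `0`, touching the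
horizontal line `im z = r` at `t = ½` only. -/
def arch (r : ℝ) : Curve ℂ :=
  ⟨⟨fun t : unitInterval => ((r * (4 * (t : ℝ) * (1 - t)) : ℝ) : ℂ) * Complex.I,
    ((Complex.continuous_ofReal.comp (by fun_prop)).mul continuous_const)⟩⟩

theorem arch_apply (r : ℝ) (t : unitInterval) :
    arch r t = ((r * (4 * (t : ℝ) * (1 - t)) : ℝ) : ℂ) * Complex.I := rfl

theorem arch_im (r : ℝ) (t : unitInterval) : (arch r t).im = r * (4 * (t : ℝ) * (1 - t)) := by
  simp [arch_apply]

theorem four_mul_mul_one_sub_le_one (x : ℝ) : 4 * x * (1 - x) ≤ 1 := by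
  nlinarith [sq_nonneg (2 * x - 1)]

theorem four_mul_mul_one_sub_nonneg {x : ℝ} (h0 : 0 ≤ x) (h1 : x ≤ 1) : 0 ≤ 4 * x * (1 - x) := by
  have : 0 ≤ 1 - x := sub_nonneg.2 h1
  positivity

/-- Arches of heights `r → 1` converge to the arch of height `1` (sup distance `≤ |r - 1|`). -/
theorem dist_arch_le (r : ℝ) : dist (arch r) (arch 1) ≤ |r - 1| := by
  refine (Curve.dist_le_dist_toContinuousMap _ _).trans ?_
  refine (ContinuousMap.dist_le (abs_nonneg _)).2 fun t => ?_
  change dist (arch r t) (arch 1 t) ≤ |r - 1|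
  rw [arch_apply, arch_apply, dist_eq_norm, ← sub_mul, norm_mul, Complex.norm_I, mul_one,
    ← Complex.ofReal_sub, Complex.norm_real, Real.norm_eq_abs,
    show r * (4 * (t : ℝ) * (1 - t)) - 1 * (4 * (t : ℝ) * (1 - t)) =
      (r - 1) * (4 * (t : ℝ) * (1 - t)) by ring, abs_mul,
    abs_of_nonneg (four_mul_mul_one_sub_nonneg t.2.1 t.2.2)]
  exact mul_le_of_le_one_right (abs_nonneg _) (four_mul_mul_one_sub_le_one _)

/-- **The obstruction is real**: for the closed half-plane `F = {im ≥ 1}` and the arch of height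
`1` (which touches `F` at its apex `i` and returns to `0`), approximated by the lower arches
(which avoid `F`), the stopping map `c ↦ [c.stopAt F]` is discontinuous. -/
theorem not_continuousAt_mk_stopAt_arch :
    ¬ ContinuousAt (fun c : Curve ℂ => CurveClass.mk (c.stopAt {z : ℂ | 1 ≤ z.im})) (arch 1) := by
  set F : Set ℂ := {z : ℂ | 1 ≤ z.im} with hF
  have hFc : IsClosed F := isClosed_le continuous_const Complex.continuous_im
  -- approximants: arches of height `1 - 1/(n+2)`
  refine not_continuousAt_mk_stopAt (γs := fun n : ℕ => arch (1 - 1 / ((n : ℝ) + 2))) ?_ ?_ ?_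
  · rw [tendsto_iff_dist_tendsto_zero]
    have h0 : Tendsto (fun n : ℕ => 1 / ((n : ℝ) + 2)) atTop (𝓝 0) := by
      have := (tendsto_one_div_add_atTop_nhds_zero_nat (𝕜 := ℝ)).comp (tendsto_add_atTop_nat 1)
      refine this.congr fun n => ?_
      simp only [Function.comp_apply, Nat.cast_add, Nat.cast_one]
      ring
    refine squeeze_zero (fun n => dist_nonneg) (fun n => ?_) h0
    refine (dist_arch_le _).trans (le_of_eq ?_)
    rw [show (1 : ℝ) - 1 / ((n : ℝ) + 2) - 1 = -(1 / ((n : ℝ) + 2)) by ring, abs_neg,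
      abs_of_nonneg (by positivity)]
  · intro n t ht
    change 1 ≤ (arch (1 - 1 / ((n : ℝ) + 2)) t).im at ht
    rw [arch_im] at ht
    have hlt : (1 - 1 / ((n : ℝ) + 2)) * (4 * (t : ℝ) * (1 - t)) < 1 := by
      have h4 := four_mul_mul_one_sub_le_one (t : ℝ)
      have hpos : 0 < 1 / ((n : ℝ) + 2) := by positivity
      have hp1 : 1 / ((n : ℝ) + 2) ≤ 1 := by
        rw [div_le_one (by positivity)]
        linarith [n.cast_nonneg (α := ℝ)]
      have hmul : (1 - 1 / ((n : ℝ) + 2)) * (4 * (t : ℝ) * (1 - t)) ≤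
          (1 - 1 / ((n : ℝ) + 2)) * 1 := mul_le_mul_of_nonneg_left h4 (by linarith)
      linarith
    exact absurd ht (not_le.2 hlt)
  · -- first contact point of the height-1 arch with `F` has `im = 1`, its endpoint has `im = 0`
    have hmem : arch 1 ⟨(arch 1).hitParam F, (arch 1).hitParam_mem_Icc F⟩ ∈ F := by
      refine Curve.apply_hitParam_mem hFc ⟨⟨1 / 2, by norm_num, by norm_num⟩, ?_⟩
      change 1 ≤ (arch 1 _).im
      rw [arch_im]
      norm_num
    intro h
    rw [h] at hmem
    change 1 ≤ ((arch 1).target).im at hmem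
    rw [Curve.target_def, arch_im] at hmem
    norm_num at hmem

/-! ### Cycle 4 (b): two hands-offs to ONE Borel reading MERGE pathwise — the certified
necessary condition NC1 of STUB 2 `stub_crosscutDictionary` -/

/-- **Merging lemma (abstract).**  On a finite measure space let `Xₙ` be random elements of a
metrisable Borel space `X`, `Yₙ`, `Zₙ` random elements of a pseudo-metric space `Y`, all
measurable, and suppose BOTH pairs `(Xₙ, Yₙ)` and `(Xₙ, Zₙ)` converge in law (tested on bounded
continuous functions of the pair) to the graph law `(ξ, f ξ)`, `ξ ∼ μ`, of ONE Borel map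
`f : X → Y`.  Then `Yₙ` and `Zₙ` merge: `∫ |h(Yₙ) - h(Zₙ)| → 0` for every bounded continuous
`h : Y → ℝ`.  Proof: approximate `h ∘ f` in `L¹(μ)` by a bounded continuous `u`
(`Integrable.exists_boundedContinuous_integral_sub_le`, `μ` is weakly regular), test the joint
convergences on `(x, y) ↦ |h y - u x|`, and use the triangle inequality. -/
theorem tendsto_integral_abs_sub_of_two_graph_limits {Ω X Y : Type*} [MeasurableSpace Ω]
    {P : Measure Ω} [IsFiniteMeasure P] [TopologicalSpace X] [TopologicalSpace.MetrizableSpace X]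
    [SecondCountableTopology X] [MeasurableSpace X] [BorelSpace X] [PseudoMetricSpace Y]
    [MeasurableSpace Y] [OpensMeasurableSpace Y] {μ : Measure X} [IsFiniteMeasure μ]
    {f : X → Y} (hf : Measurable f) {Xs : ℕ → Ω → X} {Ys Zs : ℕ → Ω → Y}
    (hX : ∀ n, Measurable (Xs n)) (hY : ∀ n, Measurable (Ys n)) (hZ : ∀ n, Measurable (Zs n))
    (hYc : ∀ G : (X × Y) →ᵇ ℝ,
      Tendsto (fun n => ∫ ω, G (Xs n ω, Ys n ω) ∂P) atTop (𝓝 (∫ x, G (x, f x) ∂μ)))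
    (hZc : ∀ G : (X × Y) →ᵇ ℝ,
      Tendsto (fun n => ∫ ω, G (Xs n ω, Zs n ω) ∂P) atTop (𝓝 (∫ x, G (x, f x) ∂μ)))
    (h : Y →ᵇ ℝ) :
    Tendsto (fun n => ∫ ω, |h (Ys n ω) - h (Zs n ω)| ∂P) atTop (𝓝 0) := by
  letI : MetricSpace X := TopologicalSpace.metrizableSpaceMetric X
  have hhf : Integrable (fun x => h (f x)) μ := by
    refine (integrable_const ‖h‖).mono' (h.continuous.measurable.comp hf).aestronglyMeasurable ?_
    exact Eventually.of_forall fun x => h.norm_coe_le_norm (f x)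
  rw [Metric.tendsto_atTop]
  intro ε hε
  obtain ⟨u, hu, -⟩ := hhf.exists_boundedContinuous_integral_sub_le (ε := ε / 4) (by positivity)
  -- the joint test function `(x, y) ↦ |h y - u x|`
  let G : (X × Y) →ᵇ ℝ := BoundedContinuousFunction.ofNormedAddCommGroup
    (fun p => |h p.2 - u p.1|)
    (continuous_abs.comp ((h.continuous.comp continuous_snd).sub (u.continuous.comp continuous_fst)))
    (‖h‖ + ‖u‖) (fun p => by
      rw [Real.norm_eq_abs, abs_abs]
      refine (abs_sub _ _).trans (add_le_add ?_ ?_)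
      · simpa [Real.norm_eq_abs] using h.norm_coe_le_norm p.2
      · simpa [Real.norm_eq_abs] using u.norm_coe_le_norm p.1)
  have hG : ∀ p, G p = |h p.2 - u p.1| := fun p => rfl
  have hsmall : ∫ x, G (x, f x) ∂μ ≤ ε / 4 := by
    simpa only [hG, Real.norm_eq_abs] using hu
  have hlt : ∫ x, G (x, f x) ∂μ < ε / 2 := by linarith
  have hYev : ∀ᶠ n in atTop, ∫ ω, G (Xs n ω, Ys n ω) ∂P < ε / 2 :=
    (hYc G).eventually (gt_mem_nhds hlt)
  have hZev : ∀ᶠ n in atTop, ∫ ω, G (Xs n ω, Zs n ω) ∂P < ε / 2 :=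
    (hZc G).eventually (gt_mem_nhds hlt)
  obtain ⟨N, hN⟩ := eventually_atTop.1 (hYev.and hZev)
  refine ⟨N, fun n hn => ?_⟩
  obtain ⟨h1, h2⟩ := hN n hn
  -- integrability of the bounded measurable integrands
  have hGY : Integrable (fun ω => G (Xs n ω, Ys n ω)) P := by
    refine (integrable_const ‖G‖).mono'
      (G.continuous.measurable.comp ((hX n).prodMk (hY n))).aestronglyMeasurable ?_
    exact Eventually.of_forall fun ω => G.norm_coe_le_norm _
  have hGZ : Integrable (fun ω => G (Xs n ω, Zs n ω)) P := by
    refine (integrable_const ‖G‖).mono'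
      (G.continuous.measurable.comp ((hX n).prodMk (hZ n))).aestronglyMeasurable ?_
    exact Eventually.of_forall fun ω => G.norm_coe_le_norm _
  have hdiff : Integrable (fun ω => |h (Ys n ω) - h (Zs n ω)|) P := by
    refine (integrable_const (‖h‖ + ‖h‖)).mono' ?_ ?_
    · exact (continuous_abs.measurable.comp ((h.continuous.measurable.comp (hY n)).sub
        (h.continuous.measurable.comp (hZ n)))).aestronglyMeasurable
    · refine Eventually.of_forall fun ω => ?_
      rw [Real.norm_eq_abs, abs_abs]
      refine (abs_sub _ _).trans (add_le_add ?_ ?_)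
      · simpa [Real.norm_eq_abs] using h.norm_coe_le_norm (Ys n ω)
      · simpa [Real.norm_eq_abs] using h.norm_coe_le_norm (Zs n ω)
  rw [Real.dist_0_eq_abs, abs_of_nonneg (integral_nonneg fun ω => abs_nonneg _)]
  calc ∫ ω, |h (Ys n ω) - h (Zs n ω)| ∂P
      ≤ ∫ ω, (G (Xs n ω, Ys n ω) + G (Xs n ω, Zs n ω)) ∂P := by
        refine integral_mono hdiff (hGY.add hGZ) fun ω => ?_
        change |h (Ys n ω) - h (Zs n ω)| ≤ |h (Ys n ω) - u (Xs n ω)| + |h (Zs n ω) - u (Xs n ω)|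
        calc |h (Ys n ω) - h (Zs n ω)|
            ≤ |h (Ys n ω) - u (Xs n ω)| + |u (Xs n ω) - h (Zs n ω)| := abs_sub_le _ _ _
          _ = |h (Ys n ω) - u (Xs n ω)| + |h (Zs n ω) - u (Xs n ω)| := by rw [abs_sub_comm (u _)]
    _ = (∫ ω, G (Xs n ω, Ys n ω) ∂P) + ∫ ω, G (Xs n ω, Zs n ω) ∂P := integral_add hGY hGZ
    _ < ε := by linarith


/-- Interfaces of a discretisation family are measurable at every positive mesh (the edge set of
`Ω_δ` is finite; `measurable_bondInterfaceIn`). -/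
theorem measurable_bondInterfaceIn_family {D : DobrushinDomain} {E : ℝ → DiscreteDobrushin}
    (hE : ZdDiscretisationFamily D E) {δ : ℝ} (hδ : 0 < δ) :
    Measurable (bondInterfaceIn D (E δ)) := by
  refine measurable_bondInterfaceIn D (E δ) ?_
  have hV : (meshDomain (E δ).Ω (E δ).δ).Finite := hE.meshDomain_finite hδ
  refine ((hV.prod hV).image (fun p : Site 2 × Site 2 => s(p.1, p.2))).subset ?_
  intro e he
  induction e using Sym2.ind with
  | _ x y =>
    have hadj := (SimpleGraph.mem_edgeSet _).1 he
    have h := discreteDomainGraph_adj_iff.1 hadj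
    exact ⟨(x, y), ⟨h.2.1, h.2.2⟩, rfl⟩

/-- **NC1 along a quad-convergent sequence (certified consequence of STUB 2).**  If a Borel
reading `Ψ` receives the joint hand-off of the interfaces of EVERY admissible discretisation
family (the `handsOff` field of `IsCrosscutDictionary`, here verbatim as hypothesis `h3` of
`stub_freeAxioms`), then for one Dobrushin domain `D` and TWO admissible families `E`, `E'` the
interfaces MERGE PATHWISE along every quad-convergent positive null sequence:
`∫ |h (γ^{D,E}_{δₙ}) - h (γ^{D,E'}_{δₙ})| dPerc → 0` for every bounded continuous `h`.  (So a
domain with two admissible families whose interfaces keep a distance in probability — e.g. a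
persistent sensitivity of the exploration path to the `o(1)` position of the discrete marked
edges `e_a`, `e_b` — would refute STUB 2; boundary-arm heuristics say the sensitivity dies out, no
kill is claimed.) -/
theorem interfaces_merge_of_handsOff
    (Ψ : DobrushinDomain → QuadConfig (Set.univ : Set ℂ) → CurveClass ℂ)
    (h1 : ∀ D : DobrushinDomain, Measurable (Ψ D))
    (h3 : ∀ (μ : FiniteMeasure (QuadConfig (Set.univ : Set ℂ))) (δs : ℕ → ℝ), (∀ n, 0 < δs n) →
        Tendsto δs atTop (𝓝 0) →
        Tendsto (fun n => z2QuadLaw (Set.univ : Set ℂ) (δs n)) atTop (𝓝 μ) →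
        ∀ (D : DobrushinDomain) (E : ℝ → DiscreteDobrushin), ZdDiscretisationFamily D E →
          ∀ f : (QuadConfig (Set.univ : Set ℂ) × CurveClass ℂ) →ᵇ ℝ,
            Tendsto (fun n => ∫ ω, f (z2QuadConfig (Set.univ : Set ℂ) (δs n) ω,
                bondInterfaceIn D (E (δs n)) ω) ∂(bondPercolation (zdGraph 2) half))
              atTop (𝓝 (∫ S, f (S, Ψ D S) ∂(μ : Measure (QuadConfig (Set.univ : Set ℂ))))))
    {μ : FiniteMeasure (QuadConfig (Set.univ : Set ℂ))} {δs : ℕ → ℝ} (hpos : ∀ n, 0 < δs n)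
    (hlim : Tendsto δs atTop (𝓝 0))
    (hμ : Tendsto (fun n => z2QuadLaw (Set.univ : Set ℂ) (δs n)) atTop (𝓝 μ))
    (D : DobrushinDomain) {E E' : ℝ → DiscreteDobrushin} (hE : ZdDiscretisationFamily D E)
    (hE' : ZdDiscretisationFamily D E') (h : CurveClass ℂ →ᵇ ℝ) :
    Tendsto (fun n => ∫ ω, |h (bondInterfaceIn D (E (δs n)) ω) -
        h (bondInterfaceIn D (E' (δs n)) ω)| ∂(bondPercolation (zdGraph 2) half)) atTop (𝓝 0) := by
  obtain ⟨⟨hK, hM, hT⟩, -⟩ :=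
    SchrammSmirnov2011_thm_1_4_holds (Set.univ : Set ℂ) isOpen_univ Set.univ_nonempty
  haveI : CompactSpace (QuadConfig (Set.univ : Set ℂ)) := hK
  haveI : T2Space (QuadConfig (Set.univ : Set ℂ)) := hT
  haveI : TopologicalSpace.MetrizableSpace (QuadConfig (Set.univ : Set ℂ)) := hM
  haveI : SecondCountableTopology (QuadConfig (Set.univ : Set ℂ)) := by
    letI : MetricSpace (QuadConfig (Set.univ : Set ℂ)) := TopologicalSpace.metrizableSpaceMetric (QuadConfig (Set.univ : Set ℂ))
    exact EMetric.secondCountable_of_sigmaCompact (QuadConfig (Set.univ : Set ℂ))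
  exact tendsto_integral_abs_sub_of_two_graph_limits (P := bondPercolation (zdGraph 2) half)
    (μ := (μ : Measure (QuadConfig (Set.univ : Set ℂ)))) (h1 D)
    (fun n => measurable_z2QuadConfig isOpen_univ (hpos n))
    (fun n => measurable_bondInterfaceIn_family hE (hpos n))
    (fun n => measurable_bondInterfaceIn_family hE' (hpos n))
    (h3 μ δs hpos hlim hμ D E hE) (h3 μ δs hpos hlim hμ D E' hE') h

/-- **NC1 along the full filter `δ → 0⁺` (certified consequence of STUB 2).**  Under the same
hands-off hypothesis the interfaces of two admissible families of one domain merge along EVERY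
positive null mesh sequence — no subsequence: every subsequence has a quad-convergent
sub-subsequence (`quadCompactness` = the landed STUB 1) along which
`interfaces_merge_of_handsOff` applies, and `tendsto_of_subseq_tendsto` concludes. -/
theorem interfaces_merge_of_handsOff'
    (Ψ : DobrushinDomain → QuadConfig (Set.univ : Set ℂ) → CurveClass ℂ)
    (h1 : ∀ D : DobrushinDomain, Measurable (Ψ D))
    (h3 : ∀ (μ : FiniteMeasure (QuadConfig (Set.univ : Set ℂ))) (δs : ℕ → ℝ), (∀ n, 0 < δs n) →
        Tendsto δs atTop (𝓝 0) →
        Tendsto (fun n => z2QuadLaw (Set.univ : Set ℂ) (δs n)) atTop (𝓝 μ) →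
        ∀ (D : DobrushinDomain) (E : ℝ → DiscreteDobrushin), ZdDiscretisationFamily D E →
          ∀ f : (QuadConfig (Set.univ : Set ℂ) × CurveClass ℂ) →ᵇ ℝ,
            Tendsto (fun n => ∫ ω, f (z2QuadConfig (Set.univ : Set ℂ) (δs n) ω,
                bondInterfaceIn D (E (δs n)) ω) ∂(bondPercolation (zdGraph 2) half))
              atTop (𝓝 (∫ S, f (S, Ψ D S) ∂(μ : Measure (QuadConfig (Set.univ : Set ℂ))))))
    {δs : ℕ → ℝ} (hpos : ∀ n, 0 < δs n) (hlim : Tendsto δs atTop (𝓝 0))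
    (D : DobrushinDomain) {E E' : ℝ → DiscreteDobrushin} (hE : ZdDiscretisationFamily D E)
    (hE' : ZdDiscretisationFamily D E') (h : CurveClass ℂ →ᵇ ℝ) :
    Tendsto (fun n => ∫ ω, |h (bondInterfaceIn D (E (δs n)) ω) -
        h (bondInterfaceIn D (E' (δs n)) ω)| ∂(bondPercolation (zdGraph 2) half)) atTop (𝓝 0) := by
  refine tendsto_of_subseq_tendsto fun ns hns => ?_
  obtain ⟨φ, hφ, μ, hμ⟩ := quadCompactness (δs ∘ ns) (fun n => hpos (ns n)) (hlim.comp hns)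
  refine ⟨φ, ?_⟩
  exact interfaces_merge_of_handsOff Ψ h1 h3 (δs := δs ∘ ns ∘ φ) (fun n => hpos _)
    ((hlim.comp hns).comp hφ.tendsto_atTop) hμ D hE hE' h

/-! ### Cycle 4 (c): the obstruction at the tree's `unitDisc`, and the thickening repair -/

/-- **OBSTRUCTION, unit-disc form (the functional of `IsTargetIndependent` / `IsLocal` at the
tree's `unitDisc`).**  Let `F` be ANY subset of the unit circle (e.g. a boundary arc `D.arc 1` of a
marking of the unit disc) and `γ` a curve in the CLOSED unit disc whose first contact with `F` is
not its endpoint.  Then `c ↦ [c.stopAt F]` is discontinuous at `γ`: the radially shrunk curves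
`(1 - 1/(n+2)) • γ` lie in the OPEN disc (as lattice interfaces do), avoid `F`, and converge to
`γ`. [folklore] -/
theorem not_continuousAt_mk_stopAt_of_subset_sphere {F : Set ℂ} (hF : F ⊆ Metric.sphere (0 : ℂ) 1)
    {γ : Curve ℂ} (hγ : ∀ t, ‖γ t‖ ≤ 1)
    (hne : γ ⟨γ.hitParam F, γ.hitParam_mem_Icc F⟩ ≠ γ.target) :
    ¬ ContinuousAt (fun c : Curve ℂ => CurveClass.mk (c.stopAt F)) γ := by
  -- radial shrinking
  let shrink : ℝ → Curve ℂ := fun r => ⟨⟨fun t => (r : ℂ) * γ t,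
    continuous_const.mul γ.continuous⟩⟩
  have shrink_apply : ∀ (r : ℝ) (t : unitInterval), shrink r t = (r : ℂ) * γ t := fun r t => rfl
  refine not_continuousAt_mk_stopAt (γs := fun n : ℕ => shrink (1 - 1 / ((n : ℝ) + 2))) ?_ ?_ hne
  · -- convergence: `dist (r • γ) γ ≤ |r - 1|`
    rw [tendsto_iff_dist_tendsto_zero]
    have h0 : Tendsto (fun n : ℕ => 1 / ((n : ℝ) + 2)) atTop (𝓝 0) := by
      have := (tendsto_one_div_add_atTop_nhds_zero_nat (𝕜 := ℝ)).comp (tendsto_add_atTop_nat 1)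
      refine this.congr fun n => ?_
      simp only [Function.comp_apply, Nat.cast_add, Nat.cast_one]
      ring
    refine squeeze_zero (fun n => dist_nonneg) (fun n => ?_) h0
    refine (Curve.dist_le_dist_toContinuousMap _ _).trans ?_
    refine (ContinuousMap.dist_le (by positivity)).2 fun t => ?_
    change dist (shrink (1 - 1 / ((n : ℝ) + 2)) t) (γ t) ≤ 1 / ((n : ℝ) + 2)
    rw [shrink_apply, dist_eq_norm,
      show ((1 - 1 / ((n : ℝ) + 2) : ℝ) : ℂ) * γ t - γ t = -(((1 / ((n : ℝ) + 2) : ℝ) : ℂ) * γ t) by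
        push_cast; ring,
      norm_neg, norm_mul, Complex.norm_real, Real.norm_eq_abs, abs_of_nonneg (by positivity)]
    exact mul_le_of_le_one_right (by positivity) (hγ t)
  · -- the shrunk curves avoid the unit circle, hence `F`
    intro n t ht
    have h1 : ‖shrink (1 - 1 / ((n : ℝ) + 2)) t‖ = 1 := by simpa using hF ht
    rw [shrink_apply, norm_mul, Complex.norm_real, Real.norm_eq_abs] at h1
    have hpos : 0 < 1 / ((n : ℝ) + 2) := by positivity
    have hp1 : 1 / ((n : ℝ) + 2) ≤ 1 := by
      rw [div_le_one (by positivity)]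
      linarith [n.cast_nonneg (α := ℝ)]
    rw [abs_of_nonneg (by linarith)] at h1
    have : (1 - 1 / ((n : ℝ) + 2)) * ‖γ t‖ ≤ (1 - 1 / ((n : ℝ) + 2)) * 1 :=
      mul_le_mul_of_nonneg_left (hγ t) (by linarith)
    linarith

/-! ### The repair: first-hitting parameters of the closed thickenings converge -/

/-- A larger target set is hit earlier. [folklore] -/
theorem hitParam_anti {E : Type*} [TopologicalSpace E] {F F' : Set E} (h : F' ⊆ F) (γ : Curve E) :
    γ.hitParam F ≤ γ.hitParam F' := by
  refine csInf_le_csInf ⟨0, fun _ ht => (γ.hitSet_subset_Icc F ht).1⟩ ⟨1, γ.one_mem_hitSet F'⟩ ?_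
  rintro t (⟨ht, hmem⟩ | ht)
  · exact Or.inl ⟨ht, h hmem⟩
  · exact Or.inr ht

/-- **REPAIR (deterministic).**  For a closed set `F` and EVERY curve `γ`, the first-hitting
parameter of the closed thickening `cthickening ε F` tends to that of `F` as `ε → 0` (along any
real sequence `εₙ → 0`; it is at most `hitParam F` since `F ⊆ cthickening εₙ F`, and any limit
point `t*` of a subsequence bounded away from `hitParam F` would satisfy `γ t* ∈ F` by closedness).
So the lattice identities behind `IsLocal` / `IsTargetIndependent` / the Markov disintegration can
be passed to the limit at the FAT stopping sets `cthickening ε F` (entered, not only touched) and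
then `ε ↓ 0` — instead of through the (unavailable) continuity of `stopAt F` itself. [folklore] -/
theorem tendsto_hitParam_cthickening {E : Type*} [PseudoEMetricSpace E] {F : Set E}
    (hF : IsClosed F) (γ : Curve E) {εs : ℕ → ℝ} (hε : Tendsto εs atTop (𝓝 0)) :
    Tendsto (fun n => γ.hitParam (Metric.cthickening (εs n) F)) atTop (𝓝 (γ.hitParam F)) := by
  set T := γ.hitParam F with hT
  have hle : ∀ n, γ.hitParam (Metric.cthickening (εs n) F) ≤ T := fun n =>
    hitParam_anti (Metric.self_subset_cthickening F) γ
  rw [tendsto_order]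
  refine ⟨fun a ha => ?_, fun a ha => Eventually.of_forall fun n => (hle n).trans_lt ha⟩
  -- lower bound: eventually `a < hitParam (cthickening (εs n) F)`
  by_contra hcon
  have hfreq : ∃ᶠ n in atTop, γ.hitParam (Metric.cthickening (εs n) F) ≤ a := by
    simpa only [not_eventually, not_lt] using hcon
  obtain ⟨φ, hφ, hφa⟩ := extraction_of_frequently_atTop hfreq
  -- the hitting parameters along `φ`, as points of `[0, 1]`
  let t : ℕ → unitInterval := fun n =>
    ⟨γ.hitParam (Metric.cthickening (εs (φ n)) F), γ.hitParam_mem_Icc _⟩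
  obtain ⟨tstar, -, ψ, hψ, hlim⟩ :=
    (isCompact_univ (X := unitInterval)).tendsto_subseq (x := t) fun _ => mem_univ _
  -- each thickening is met (its hitting parameter is `≤ a < T ≤ 1`), at the point `γ (t n)`
  have hmem : ∀ n, γ (t n) ∈ Metric.cthickening (εs (φ n)) F := by
    intro n
    apply Curve.apply_hitParam_mem Metric.isClosed_cthickening
    by_contra hno
    push Not at hno
    have h1 : γ.hitParam (Metric.cthickening (εs (φ n)) F) = 1 :=
      Curve.hitParam_eq_one_of_forall_notMem hno
    have : T ≤ 1 := (γ.hitParam_mem_Icc F).2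
    linarith [hφa n]
  -- the limit point `γ tstar` lies in `F`
  have hstar : γ tstar ∈ F := by
    rw [← hF.closure_eq, Metric.mem_closure_iff_infEDist_zero]
    refine le_antisymm ?_ bot_le
    have hcont : Tendsto (fun n => Metric.infEDist (γ (t (ψ n))) F) atTop
        (𝓝 (Metric.infEDist (γ tstar) F)) :=
      ((Metric.continuous_infEDist.comp γ.continuous).tendsto tstar).comp hlim
    have hbound : ∀ n, Metric.infEDist (γ (t (ψ n))) F ≤ ENNReal.ofReal (εs (φ (ψ n))) :=
      fun n => Metric.mem_cthickening_iff.1 (hmem (ψ n))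
    have hzero : Tendsto (fun n => ENNReal.ofReal (εs (φ (ψ n)))) atTop (𝓝 0) := by
      rw [← ENNReal.ofReal_zero]
      exact ENNReal.tendsto_ofReal ((hε.comp hφ.tendsto_atTop).comp hψ.tendsto_atTop)
    exact le_of_tendsto_of_tendsto hcont hzero (Eventually.of_forall hbound)
  -- hence `T ≤ tstar ≤ a < T`
  have hT_le : T ≤ (tstar : ℝ) := Curve.hitParam_le hstar
  have hts_le : (tstar : ℝ) ≤ a := by
    have hcoe : Tendsto (fun n => ((t (ψ n) : unitInterval) : ℝ)) atTop (𝓝 (tstar : ℝ)) :=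
      (continuous_subtype_val.tendsto tstar).comp hlim
    exact le_of_tendsto hcoe (Eventually.of_forall fun n => hφa (ψ n))
  linarith

end Summit.CriticalPhenomena.CardyFormulaZ2.Cruxes.LagHandOff.Disproof

end
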